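import Literature.Probability.RandomPlanarGeometry.RestrictionSemigroup
import Literature.Probability.RandomPlanarGeometry.ConformalMapRiemannNormalisedProofs
import Literature.Probability.RandomPlanarGeometry.ConformalMapProofs
import Literature.Probability.RandomPlanarGeometry.HalfPlaneAutomorphism
import Literature.Analysis.Complex.HalfPlaneRigidity
import Literature.Analysis.Complex.SimplyConnectedOfCompl
import Mathlib.Analysis.Calculus.Deriv.Star
import Mathlib.Topology.Bornology.BoundedOperation
import HarnessLib

/-!
# The normalized maps `Φ_A` of one-sided hulls via the symmetric Riemann map (Lawler–Schramm–Werner 2003, §2)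

G. F. Lawler, O. Schramm, W. Werner, *Conformal restriction: the chordal case*, J. Amer. Math.
Soc. **16** (2003) 917–955, arXiv:math/0209343 (**[LSW]**, arXiv page numbers), §2 pp. 7–8, use
for a hull `A` of the upper half-plane the conformal map `g_A : ℍ ∖ A → ℍ` with the hydrodynamic
normalization and `Φ_A = g_A - g_A(0)`, "the unique conformal transformation `Φ` of `ℍ ∖ A` onto
`ℍ` fixing `0` and `∞` with `Φ(z)/z → 1` as `z → ∞`", together with the bound **(2.4)**
`0 < Φ_A'(0) ≤ 1`; in the tree these are the named facts
`Literature.Probability.RandomPlanarGeometry.IsStarHull.existsUnique_isRestrictionMap` and `Literature.Probability.RandomPlanarGeometry.IsStarHull.exists_hasRestrictionDeriv` of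
`RestrictionHulls`. This file CONSTRUCTS `Φ_A` and PROVES all of this for **one-sided**
`*`-hulls — hulls whose real points lie in a compact real segment `[p, q] ∌ 0` with the endpoint
`p` free (`Literature.Probability.RandomPlanarGeometry.IsSlitHull`; every nonempty `A ∈ 𝒬₊ ∪ 𝒬₋` is such) — following the classical
symmetrization argument for the existence of `g_A` (G. F. Lawler, *Conformally Invariant Processes
in the Plane*, AMS (2005), §3.4, Prop. 3.36 and its proof, pp. 68–69: extend `g` to the reflected
domain by Schwarz reflection, expand at `∞`, "since reals are sent to reals … `b_j ∈ ℝ`, and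
since points in `ℍ` are sent to points in `ℍ`, `b_{-1} > 0`", then normalize by the affine
self-maps of `ℍ`), but with the reflection principle REPLACED by the uniqueness of the normalized
Riemann map of a symmetric domain:

* the compact set `K = A ∪ Ā ∪ [p, q]` is connected and symmetric, `Ω = ℂ ∖ K ∋ 0` is a
  symmetric domain with `Ω ∩ ℍ = ℍ ∖ A` (`Literature.Probability.RandomPlanarGeometry.slitDomain`), and after the inversion
  `ι(z) = (z - p)⁻¹` the domain `G = ι(Ω) ∪ {0}` (`Literature.Probability.RandomPlanarGeometry.slitBall`) is simply connected
  (`Complex.isSimplyConnected_of_compl`, Conway VIII.2.2: its complement `ι(K ∖ {p})` is connected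
  and unbounded) — all PROVED (`Literature.Probability.RandomPlanarGeometry.IsSlitHull.isSimplyConnected_slitBall`);
* the normalized Riemann map `f : G → 𝔻`, `f(0) = 0`, `f'(0) > 0`
  (`Literature.Probability.RandomPlanarGeometry.exists_conformalEquiv_ball_deriv_pos`) commutes with complex conjugation, by uniqueness
  (`Literature.Probability.RandomPlanarGeometry.ConformalEquiv.eqOn_of_deriv_pos`) applied to `z ↦ conj f(z̄)`
  (`Literature.Probability.RandomPlanarGeometry.exists_symmetric_riemannMap`);
* hence `F = f ∘ ι` maps `ℍ ∖ A` onto the lower half-disc and the Joukowski map `J(w) = w + w⁻¹`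
  maps that onto `ℍ`; `E = f'(0) · (J ∘ F - J(F(0)))` (`Literature.Probability.RandomPlanarGeometry.IsSlitHull.ext`) is an injective
  holomorphic function on `Ω ∋ 0`, real on `Ω ∩ ℝ`, with `E(Ω ∩ ℍ) = ℍ`, `E(0) = 0`,
  `E(z)/z → 1` (`tendsto_ext_div`) and `E(z) - z → L ∈ ℝ` (`exists_tendsto_ext_sub`) at `∞`; its
  restriction is `Φ_A` (`Literature.Probability.RandomPlanarGeometry.IsSlitHull.restrictionMap`, `isRestrictionMap`), with
  `Φ_A'(0) = E'(0) > 0` (`hasRestrictionDeriv`, `restrictionDeriv_pos`), and `Φ_A'(0) ≤ 1`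
  (`restrictionDeriv_le_one`) follows from `im Φ_A(z) ≤ im z` (`im_ext_le_im`), the boundary
  Julia lemma `Complex.im_le_im_of_tendsto_sub_self` applied to the self-map `Φ_A⁻¹ + L` of `ℍ`;
* uniqueness (`Literature.Probability.RandomPlanarGeometry.IsRestrictionMap.eqOn_of_tendsto_symm`, `Literature.Probability.RandomPlanarGeometry.IsSlitHull.eqOn_restrictionMap`):
  for a second restriction map `Ψ`, `Ψ ∘ Φ_A⁻¹` is a conformal automorphism of `ℍ` tending to `0`
  at `0` and to `∞` at `∞` (`tendsto_symm_nhdsWithin_zero`, `tendsto_symm_cocompact`), hence a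
  dilation (`Literature.Probability.RandomPlanarGeometry.ConformalEquiv.exists_eqOn_smul_of_tendsto`), and the factor is `1`; so
  `Φ'_A(0) ∈ (0, 1]` for EVERY restriction map of a one-sided hull
  (`Literature.Probability.RandomPlanarGeometry.IsSlitHull.exists_hasRestrictionDeriv`).

Two-sided hulls `A ∈ 𝒬*` are products of one-sided ones ([LSW] §2 p. 8, "`A = A₁ · A₂`"); the
general facts are to be assembled from this file in a sibling file. No new named facts here.

Mathlib: `dslope`, `HasDerivAt.tendsto_slope_zero`, `HasDerivAt.comp_ofReal`,
`DifferentiableAt.conj_conj` / `deriv_conj_conj`, `HasFPowerSeriesAt.has_fpower_series_dslope_fslope`,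
`IsPreconnected.subset_or_subset`, `Set.OrdConnected.isPreconnected`, `tendsto_inv₀_cobounded`,
`Complex.cpow_nat_inv_pow` (square roots, for the surjectivity of `J`); from Literature
`Complex.differentiableOn_invFunOn_image`, `Complex.isOpen_image_of_deriv_ne_zero`,
`Literature.Probability.RandomPlanarGeometry.ConformalEquiv.ofBijOn`, `Literature.Probability.RandomPlanarGeometry.ConformalEquiv.deriv_ne_zero_holds`.

## References

* G. F. Lawler, O. Schramm, W. Werner, *Conformal restriction: the chordal case*, JAMS 16 (2003),
  §2 pp. 7–8 and (2.4).
* G. F. Lawler, *Conformally Invariant Processes in the Plane*, Math. Surveys Monogr. 114, AMS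
  (2005), §3.4, Prop. 3.36, pp. 68–69.
-/

noncomputable section

open Set Filter Topology Metric Bornology Complex
open UpperHalfPlane (upperHalfPlaneSet isOpen_upperHalfPlaneSet)
open scoped ComplexConjugate

namespace Literature.Probability.RandomPlanarGeometry

/-! ### The Joukowski map `J(w) = w + w⁻¹` on the punctured disc -/

/-- The **Joukowski map** `J(w) = w + w⁻¹`; it maps the lower open half of the unit disc
conformally onto the upper half-plane. [folklore] -/
def joukowski (w : ℂ) : ℂ := w + w⁻¹

/-- The lower open half of the unit disc. [folklore] -/
def lowerHalfDisc : Set ℂ := {w : ℂ | ‖w‖ < 1 ∧ w.im < 0}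

/-- `J` commutes with complex conjugation. [folklore] -/
theorem joukowski_conj (w : ℂ) : joukowski (conj w) = conj (joukowski w) := by
  simp [joukowski, map_add, map_inv₀]

/-- The imaginary part of `J(w)`: `im w · (1 - |w|⁻²)`. [folklore] -/
theorem joukowski_im (w : ℂ) : (joukowski w).im = w.im * (1 - (normSq w)⁻¹) := by
  simp only [joukowski, add_im, inv_im]
  ring

/-- `J` is real on reals. [folklore] -/
theorem joukowski_ofReal_im (x : ℝ) : (joukowski x).im = 0 := by
  simp [joukowski_im]

/-- `|w| < 1 ⇒ normSq w < 1`. [folklore] -/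
theorem normSq_lt_one_of_norm_lt_one {w : ℂ} (hw : ‖w‖ < 1) : normSq w < 1 := by
  rw [normSq_eq_norm_sq]
  nlinarith [norm_nonneg w]

/-- On the punctured unit disc off the real axis, `im J(w)` and `im w` have opposite signs. [folklore] -/
theorem one_sub_inv_normSq_neg {w : ℂ} (hw : ‖w‖ < 1) (hw0 : w ≠ 0) : 1 - (normSq w)⁻¹ < 0 := by
  have h1 : normSq w < 1 := normSq_lt_one_of_norm_lt_one hw
  have h0 : 0 < normSq w := normSq_pos.2 hw0
  have : 1 < (normSq w)⁻¹ := (one_lt_inv₀ h0).2 h1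
  linarith

/-- On the lower half of the unit disc, `im J > 0`. [folklore] -/
theorem joukowski_im_pos {w : ℂ} (hw : ‖w‖ < 1) (hw' : w.im < 0) : 0 < (joukowski w).im := by
  have hw0 : w ≠ 0 := fun h ↦ by simp [h] at hw'
  rw [joukowski_im]
  exact mul_pos_of_neg_of_neg hw' (one_sub_inv_normSq_neg hw hw0)

/-- On the upper half of the unit disc, `im J < 0`. [folklore] -/
theorem joukowski_im_neg {w : ℂ} (hw : ‖w‖ < 1) (hw' : 0 < w.im) : (joukowski w).im < 0 := by
  have hw0 : w ≠ 0 := fun h ↦ by simp [h] at hw'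
  rw [joukowski_im]
  exact mul_neg_of_pos_of_neg hw' (one_sub_inv_normSq_neg hw hw0)

/-- `J` maps the lower half-disc into `ℍₒ`. [folklore] -/
theorem mapsTo_joukowski : MapsTo joukowski lowerHalfDisc upperHalfPlaneSet :=
  fun _ hw ↦ joukowski_im_pos hw.1 hw.2

/-- The factorization `J(w₁) - J(w₂) = (w₁ - w₂)(1 - (w₁w₂)⁻¹)`. [folklore] -/
theorem joukowski_sub {w₁ w₂ : ℂ} (h₁ : w₁ ≠ 0) (h₂ : w₂ ≠ 0) :
    joukowski w₁ - joukowski w₂ = (w₁ - w₂) * (1 - (w₁ * w₂)⁻¹) := by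
  simp only [joukowski]
  field_simp
  ring

/-- `J` is injective on the punctured unit disc. [folklore] -/
theorem injOn_joukowski : InjOn joukowski (ball (0 : ℂ) 1 \ {0}) := by
  rintro w₁ ⟨hw₁, hw₁0⟩ w₂ ⟨hw₂, hw₂0⟩ h
  rw [mem_ball_zero_iff] at hw₁ hw₂
  have h0 : joukowski w₁ - joukowski w₂ = 0 := sub_eq_zero.2 h
  rw [joukowski_sub hw₁0 hw₂0, mul_eq_zero] at h0
  rcases h0 with h0 | h0
  · exact sub_eq_zero.1 h0
  · exfalso
    have h1 : (w₁ * w₂)⁻¹ = 1 := (sub_eq_zero.1 h0).symm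
    have h2 : ‖w₁ * w₂‖ < 1 := by
      rw [norm_mul]
      nlinarith [norm_nonneg w₁, norm_nonneg w₂]
    rw [inv_eq_one] at h1
    rw [h1, norm_one] at h2
    exact lt_irrefl _ h2

/-- `J'(w) = 1 - w⁻²` off `0`. [folklore] -/
theorem hasDerivAt_joukowski {w : ℂ} (hw : w ≠ 0) :
    HasDerivAt joukowski (1 - (w ^ 2)⁻¹) w := by
  have h : HasDerivAt (fun y : ℂ ↦ y + y⁻¹) (1 + -(w ^ 2)⁻¹) w :=
    (hasDerivAt_id w).add (hasDerivAt_inv hw)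
  have h' : (1 : ℂ) + -(w ^ 2)⁻¹ = 1 - (w ^ 2)⁻¹ := by ring
  rw [h'] at h
  exact h

/-- `J` is holomorphic off `0`. [folklore] -/
theorem differentiableAt_joukowski {w : ℂ} (hw : w ≠ 0) : DifferentiableAt ℂ joukowski w :=
  (hasDerivAt_joukowski hw).differentiableAt

/-- `J'(w) = 1 - w⁻²`. [folklore] -/
theorem deriv_joukowski {w : ℂ} (hw : w ≠ 0) : deriv joukowski w = 1 - (w ^ 2)⁻¹ :=
  (hasDerivAt_joukowski hw).deriv

/-- `J' ≠ 0` on the punctured unit disc. [folklore] -/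
theorem deriv_joukowski_ne_zero {w : ℂ} (hw : ‖w‖ < 1) (hw0 : w ≠ 0) : deriv joukowski w ≠ 0 := by
  rw [deriv_joukowski hw0]
  intro h
  have h1 : (w ^ 2)⁻¹ = 1 := (sub_eq_zero.1 h).symm
  rw [inv_eq_one] at h1
  have : ‖w‖ ^ 2 = 1 := by rw [← norm_pow, h1, norm_one]
  nlinarith [norm_nonneg w]

/-- `J` is continuous off `0`. [folklore] -/
theorem continuousOn_joukowski : ContinuousOn joukowski {0}ᶜ := fun _ hw ↦
  (differentiableAt_joukowski hw).continuousAt.continuousWithinAt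

/-- A lower bound: `‖J(w)‖ ≥ ‖w‖⁻¹ - 1` on the unit disc. [folklore] -/
theorem inv_norm_sub_one_le_norm_joukowski {w : ℂ} (hw : ‖w‖ < 1) :
    ‖w‖⁻¹ - 1 ≤ ‖joukowski w‖ := by
  have h : ‖w⁻¹‖ ≤ ‖w + w⁻¹‖ + ‖w‖ := by
    calc ‖w⁻¹‖ = ‖(w + w⁻¹) - w‖ := by rw [add_sub_cancel_left]
      _ ≤ ‖w + w⁻¹‖ + ‖w‖ := norm_sub_le _ _
  rw [norm_inv] at h
  simp only [joukowski]
  linarith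

/-- `J` maps the lower half-disc ONTO `ℍₒ`: for `ζ ∈ ℍₒ` the roots of `w² - ζ w + 1` are
non-real, off the unit circle, with product `1`; the one inside the disc is in the lower half. [folklore] -/
theorem surjOn_joukowski : SurjOn joukowski lowerHalfDisc upperHalfPlaneSet := by
  intro ζ hζ
  have hζim : 0 < ζ.im := hζ
  -- a square root of the discriminant
  obtain ⟨s, hs⟩ : ∃ s : ℂ, s ^ 2 = ζ ^ 2 - 4 := by
    refine ⟨(ζ ^ 2 - 4) ^ ((2 : ℂ)⁻¹), ?_⟩
    have h := Complex.cpow_nat_inv_pow (ζ ^ 2 - 4) (n := 2) two_ne_zero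
    simpa only [Nat.cast_ofNat] using h
  set w₁ : ℂ := (ζ + s) / 2 with hw₁
  set w₂ : ℂ := (ζ - s) / 2 with hw₂
  have hprod : w₁ * w₂ = 1 := by
    rw [hw₁, hw₂]
    have : (ζ + s) / 2 * ((ζ - s) / 2) = (ζ ^ 2 - s ^ 2) / 4 := by ring
    rw [this, hs]
    ring
  have hsum : w₁ + w₂ = ζ := by rw [hw₁, hw₂]; ring
  -- both roots solve `J w = ζ`
  have hJ : ∀ {a b : ℂ}, a * b = 1 → a + b = ζ → joukowski a = ζ := by
    intro a b hab habζ
    have ha : a ≠ 0 := left_ne_zero_of_mul_eq_one hab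
    have hb : b = a⁻¹ := by rw [← mul_eq_one_iff_eq_inv₀ ha, mul_comm]; exact hab
    rw [joukowski, ← hb, habζ]
  have hJ₁ : joukowski w₁ = ζ := hJ hprod hsum
  have hJ₂ : joukowski w₂ = ζ := hJ (by rw [mul_comm]; exact hprod) (by rw [add_comm]; exact hsum)
  -- a root `w` with `J w = ζ` inside the disc lies in the lower half-disc
  have key : ∀ w : ℂ, joukowski w = ζ → ‖w‖ < 1 → w ∈ lowerHalfDisc := by
    intro w hw hwn
    refine ⟨hwn, ?_⟩
    have hw0 : w ≠ 0 := by
      rintro rfl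
      simp [joukowski] at hw
      rw [← hw] at hζim
      simp at hζim
    have him : 0 < w.im * (1 - (normSq w)⁻¹) := by rw [← joukowski_im, hw]; exact hζim
    have hneg := one_sub_inv_normSq_neg hwn hw0
    by_contra hle
    push Not at hle
    have : w.im * (1 - (normSq w)⁻¹) ≤ 0 := mul_nonpos_of_nonneg_of_nonpos hle hneg.le
    linarith
  -- no root lies on the unit circle
  have hcirc : ∀ w : ℂ, joukowski w = ζ → ‖w‖ ≠ 1 := by
    intro w hw h1
    have hw0 : w ≠ 0 := by rintro rfl; simp at h1
    have hinv : w⁻¹ = conj w := by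
      rw [inv_def, normSq_eq_norm_sq, h1]
      simp
    have : (joukowski w).im = 0 := by
      rw [joukowski, hinv, add_im, conj_im, add_neg_cancel]
    rw [hw] at this
    exact absurd this hζim.ne'
  rcases lt_or_gt_of_ne (hcirc w₁ hJ₁) with h₁ | h₁
  · exact ⟨w₁, key w₁ hJ₁ h₁, hJ₁⟩
  · refine ⟨w₂, key w₂ hJ₂ ?_, hJ₂⟩
    have hn : ‖w₁‖ * ‖w₂‖ = 1 := by rw [← norm_mul, hprod, norm_one]
    by_contra hle
    push Not at hle
    have : 1 < ‖w₁‖ * ‖w₂‖ := by nlinarith [norm_nonneg w₂]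
    linarith

/-- The lower half-disc lies in the punctured unit disc. [folklore] -/
theorem lowerHalfDisc_subset : lowerHalfDisc ⊆ ball (0 : ℂ) 1 \ {0} := fun w hw ↦
  ⟨mem_ball_zero_iff.2 hw.1, fun h ↦ by
    have h0 : w = 0 := h
    have h2 := hw.2
    rw [h0, Complex.zero_im] at h2
    exact lt_irrefl _ h2⟩

/-- `J` maps the lower half-disc bijectively onto `ℍₒ`. [folklore] -/
theorem bijOn_joukowski : BijOn joukowski lowerHalfDisc upperHalfPlaneSet :=
  ⟨mapsTo_joukowski, injOn_joukowski.mono lowerHalfDisc_subset, surjOn_joukowski⟩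

/-! ### The symmetric Riemann map -/

section SymmetricRiemann

variable {G : Set ℂ}

/-- The conjugate `z ↦ conj (f (conj z))` of a conformal equivalence of a conjugation-symmetric
set onto the unit disc is again one. [folklore] -/
def ConformalEquiv.conjBall (f : ConformalEquiv G (ball (0 : ℂ) 1)) (hG : IsOpen G)
    (hsymm : ∀ z ∈ G, conj z ∈ G) : ConformalEquiv G (ball (0 : ℂ) 1) where
  toPartialEquiv :=
    { toFun := fun z ↦ conj (f (conj z))
      invFun := fun w ↦ conj (f.symm (conj w))
      source := G
      target := ball 0 1
      map_source' := fun z hz ↦ by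
        have h := f.mapsTo (hsymm z hz)
        rw [mem_ball_zero_iff] at h ⊢
        rwa [norm_conj]
      map_target' := fun w hw ↦ by
        have hw' : conj w ∈ ball (0 : ℂ) 1 := by
          rw [mem_ball_zero_iff] at hw ⊢
          rwa [norm_conj]
        exact hsymm _ (f.symm_mapsTo hw')
      left_inv' := fun z hz ↦ by
        simp only [conj_conj]
        rw [f.symm_apply_apply (hsymm z hz), conj_conj]
      right_inv' := fun w hw ↦ by
        have hw' : conj w ∈ ball (0 : ℂ) 1 := by
          rw [mem_ball_zero_iff] at hw ⊢
          rwa [norm_conj]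
        simp only [conj_conj]
        rw [f.apply_symm_apply hw', conj_conj] }
  source_eq := rfl
  target_eq := rfl
  differentiableOn := by
    intro z hz
    have hd : DifferentiableAt ℂ f (conj z) :=
      f.differentiableOn_coe.differentiableAt (hG.mem_nhds (hsymm z hz))
    have := hd.conj_conj
    rw [conj_conj] at this
    exact this.differentiableWithinAt
  differentiableOn_symm := by
    intro w hw
    have hw' : conj w ∈ ball (0 : ℂ) 1 := by
      rw [mem_ball_zero_iff] at hw ⊢
      rwa [norm_conj]
    have hd : DifferentiableAt ℂ f.symm (conj w) :=
      f.symm.differentiableOn_coe.differentiableAt (isOpen_ball.mem_nhds hw')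
    have := hd.conj_conj
    rw [conj_conj] at this
    exact this.differentiableWithinAt

/-- Unfolding `conjBall`. [folklore] -/
theorem ConformalEquiv.conjBall_apply (f : ConformalEquiv G (ball (0 : ℂ) 1)) (hG : IsOpen G)
    (hsymm : ∀ z ∈ G, conj z ∈ G) (z : ℂ) : f.conjBall hG hsymm z = conj (f (conj z)) := rfl

/-- The conjugated map as a composition `conj ∘ f ∘ conj`. [folklore] -/
theorem ConformalEquiv.coe_conjBall (f : ConformalEquiv G (ball (0 : ℂ) 1)) (hG : IsOpen G)
    (hsymm : ∀ z ∈ G, conj z ∈ G) :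
    ((f.conjBall hG hsymm : ConformalEquiv G (ball (0 : ℂ) 1)) : ℂ → ℂ) = conj ∘ f ∘ conj := rfl

/-- **The symmetric Riemann map.** For a conjugation-symmetric simply connected open
`G ⊊ ℂ` containing `0`, the normalized Riemann map `f : G → 𝔻` (`f(0) = 0`, `f'(0) > 0`)
commutes with complex conjugation: `z ↦ conj f(z̄)` is normalized too, so equals `f` by the
uniqueness part of the Riemann mapping theorem. [folklore] -/
theorem exists_symmetric_riemannMap (hG : IsOpen G) (hsc : IsSimplyConnected G) (hG' : G ≠ univ)
    (h0 : (0 : ℂ) ∈ G) (hsymm : ∀ z ∈ G, conj z ∈ G) :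
    ∃ f : ConformalEquiv G (ball (0 : ℂ) 1), f 0 = 0 ∧ 0 < (deriv f 0).re ∧ (deriv f 0).im = 0 ∧
      ∀ z ∈ G, f (conj z) = conj (f z) := by
  obtain ⟨f, hf0, hre, him⟩ := exists_conformalEquiv_ball_deriv_pos hG hsc hG' h0
  refine ⟨f, hf0, hre, him, ?_⟩
  set g := f.conjBall hG hsymm with hg
  have hg0 : g 0 = 0 := by
    rw [hg, ConformalEquiv.conjBall_apply, map_zero, hf0, map_zero]
  have hdg : deriv g 0 = conj (deriv f 0) := by
    rw [hg, ConformalEquiv.coe_conjBall, deriv_conj_conj]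
    simp
  have hgre : 0 < (deriv g 0).re := by rw [hdg, conj_re]; exact hre
  have hgim : (deriv g 0).im = 0 := by rw [hdg, conj_im, him, neg_zero]
  have heq : EqOn g f G := ConformalEquiv.eqOn_of_deriv_pos hG h0 f g hf0 hg0 hre him hgre hgim
  intro z hz
  have h := heq (hsymm z hz)
  rw [hg, ConformalEquiv.conjBall_apply, conj_conj] at h
  exact h.symm

end SymmetricRiemann

/-! ### A topological lemma: replacing one half of a connected union -/

/-- If `s ∪ t` is preconnected (`s`, `t` closed, `t` nonempty) and the preconnected set `t'`
contains `s ∩ t`, then `s ∪ t'` is preconnected. [folklore] -/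
theorem IsPreconnected.union_of_inter_subset {X : Type*} [TopologicalSpace X] {s t t' : Set X}
    (h : IsPreconnected (s ∪ t)) (hs : IsClosed s) (ht : IsClosed t) (htne : t.Nonempty)
    (ht' : IsPreconnected t') (hsub : s ∩ t ⊆ t') : IsPreconnected (s ∪ t') := by
  rw [isPreconnected_iff_subset_of_disjoint_closed] at h ht' ⊢
  -- the key step, for `t' ⊆ u`
  have key : ∀ u v : Set X, IsClosed u → IsClosed v → s ∪ t' ⊆ u ∪ v →
      (s ∪ t') ∩ (u ∩ v) = ∅ → t' ⊆ u → s ∪ t' ⊆ u := by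
    intro u v hu hv hcov hdis ht'u
    have hcov' : s ∪ t ⊆ (u ∪ t) ∪ (v ∩ s) := by
      rintro x (hx | hx)
      · rcases hcov (Or.inl hx) with h' | h'
        · exact Or.inl (Or.inl h')
        · exact Or.inr ⟨h', hx⟩
      · exact Or.inl (Or.inr hx)
    have hdis' : (s ∪ t) ∩ ((u ∪ t) ∩ (v ∩ s)) = ∅ := by
      rw [← subset_empty_iff, ← hdis]
      rintro z ⟨-, hzu | hzt, hzv, hzs⟩
      · exact ⟨Or.inl hzs, hzu, hzv⟩
      · exact ⟨Or.inl hzs, ht'u (hsub ⟨hzs, hzt⟩), hzv⟩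
    rcases h (u ∪ t) (v ∩ s) (hu.union ht) (hv.inter hs) hcov' hdis' with h1 | h1
    · rintro x (hx | hx)
      · rcases h1 (Or.inl hx) with h2 | h2
        · exact h2
        · exact ht'u (hsub ⟨hx, h2⟩)
      · exact ht'u hx
    · exfalso
      obtain ⟨y, hy⟩ := htne
      obtain ⟨hyv, hys⟩ := h1 (Or.inr hy)
      have hyu : y ∈ u := ht'u (hsub ⟨hys, hy⟩)
      have : y ∈ (s ∪ t') ∩ (u ∩ v) := ⟨Or.inl hys, hyu, hyv⟩
      rw [hdis] at this
      exact this
  intro u v hu hv hcov hdis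
  have hdis₀ : t' ∩ (u ∩ v) = ∅ := by
    rw [← subset_empty_iff, ← hdis]
    exact inter_subset_inter_left _ subset_union_right
  rcases ht' u v hu hv (subset_union_right.trans hcov) hdis₀ with h1 | h1
  · exact Or.inl (key u v hu hv hcov hdis h1)
  · exact Or.inr (key v u hv hu (by rw [union_comm v u]; exact hcov)
      (by rw [inter_comm v u]; exact hdis) h1)

/-! ### One-sided hulls and the symmetric slit domain -/

section Slit

variable {A : Set ℂ} {p q : ℝ}

/-- The real segment between `p` and `q` (in either order), as a subset of `ℂ`. [folklore] -/
def realSeg (p q : ℝ) : Set ℂ := (fun x : ℝ ↦ (x : ℂ)) '' uIcc p q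

/-- A real point lies in the real segment iff it lies in `uIcc p q`. [folklore] -/
theorem ofReal_mem_realSeg {x : ℝ} : (x : ℂ) ∈ realSeg p q ↔ x ∈ uIcc p q := by
  refine ⟨?_, fun hx ↦ ⟨x, hx, rfl⟩⟩
  rintro ⟨y, hy, hyx⟩
  rwa [← ofReal_inj.1 hyx]

/-- Points of the real segment are real. [folklore] -/
theorem im_eq_zero_of_mem_realSeg {z : ℂ} (hz : z ∈ realSeg p q) : z.im = 0 := by
  obtain ⟨x, -, rfl⟩ := hz
  exact ofReal_im x

/-- Membership in the real segment via real and imaginary parts. [folklore] -/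
theorem mem_realSeg_iff {z : ℂ} : z ∈ realSeg p q ↔ z.im = 0 ∧ z.re ∈ uIcc p q := by
  refine ⟨fun hz ↦ ⟨im_eq_zero_of_mem_realSeg hz, ?_⟩, fun ⟨h1, h2⟩ ↦ ⟨z.re, h2, ?_⟩⟩
  · obtain ⟨x, hx, rfl⟩ := hz
    rwa [ofReal_re]
  · exact Complex.ext (by simp) (by simp [h1])

/-- The real segment is conjugation-invariant. [folklore] -/
theorem conj_mem_realSeg_iff {z : ℂ} : conj z ∈ realSeg p q ↔ z ∈ realSeg p q := by
  rw [mem_realSeg_iff, mem_realSeg_iff, conj_im, conj_re, neg_eq_zero]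

/-- The real segment is compact. [folklore] -/
theorem isCompact_realSeg : IsCompact (realSeg p q) :=
  isCompact_uIcc.image continuous_ofReal

/-- A convex combination of `p` and `q` lies in `uIcc p q`. [folklore] -/
theorem add_mul_sub_mem_uIcc {t : ℝ} (ht0 : 0 ≤ t) (ht1 : t ≤ 1) : p + t * (q - p) ∈ uIcc p q := by
  rcases le_total p q with hpq | hpq
  · rw [uIcc_of_le hpq]
    constructor <;> nlinarith
  · rw [uIcc_of_ge hpq]
    constructor <;> nlinarith

/-- `uIcc p q` minus its endpoint `p` is order-connected, hence preconnected. [folklore] -/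
theorem ordConnected_uIcc_diff : (uIcc p q \ {p}).OrdConnected := by
  refine ⟨fun a ha b hb c hc ↦ ⟨ordConnected_uIcc.out ha.1 hb.1 hc, fun hcp ↦ ?_⟩⟩
  have hcp' : c = p := hcp
  rcases le_total p q with hpq | hpq
  · have ha1 := ha.1
    rw [uIcc_of_le hpq] at ha1
    have : a ≠ p := ha.2
    have : p < a := lt_of_le_of_ne ha1.1 (Ne.symm this)
    linarith [hc.1]
  · have hb1 := hb.1
    rw [uIcc_of_ge hpq] at hb1
    have : b ≠ p := hb.2
    have : b < p := lt_of_le_of_ne hb1.2 this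
    linarith [hc.2]

/-- **One-sided `*`-hull with slit data `(p, q)`**: a nonempty `A ∈ 𝒬*` without floating
pieces (`A ∪ {Im ≤ 0}` connected — automatic for hulls, `IsBoundedHull.isConnected_union_im_nonpos`)
whose real points lie in the real segment from `p` to `q`, off the endpoint `p`, the segment not
containing `0`. Every nonempty `A ∈ 𝒬₊` (`p = min (A ∩ ℝ)/2`, `q = max (A ∩ ℝ)`) and every
nonempty `A ∈ 𝒬₋` is such. For these hulls the symmetrization `ℂ ∖ (A ∪ Ā ∪ [p, q])` is a
simply connected domain of the sphere containing `0` and `∞`. [folklore] -/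
structure IsSlitHull (A : Set ℂ) (p q : ℝ) : Prop where
  isStarHull : IsStarHull A
  nonempty : A.Nonempty
  isConnected_union : IsConnected (A ∪ {z : ℂ | z.im ≤ 0})
  zero_notMem_uIcc : (0 : ℝ) ∉ uIcc p q
  mem_uIcc : ∀ x : ℝ, (x : ℂ) ∈ A → x ∈ uIcc p q ∧ x ≠ p

/-- The symmetric compact set `K = A ∪ Ā ∪ [p, q]`. [folklore] -/
def slitCompact (A : Set ℂ) (p q : ℝ) : Set ℂ := (A ∪ {z | conj z ∈ A}) ∪ realSeg p q

/-- The symmetric slit domain `Ω = ℂ ∖ K`. [folklore] -/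
def slitDomain (A : Set ℂ) (p q : ℝ) : Set ℂ := (slitCompact A p q)ᶜ

/-- The inversion `ι(z) = (z - p)⁻¹` centred at the free endpoint `p`. [folklore] -/
def ofSlit (p : ℝ) (z : ℂ) : ℂ := (z - p)⁻¹

/-- Its inverse `κ(w) = p + w⁻¹`. [folklore] -/
def toSlit (p : ℝ) (w : ℂ) : ℂ := (p : ℂ) + w⁻¹

/-- The inverted domain `G = ι(Ω) ∪ {0}` (`0 = ι(∞)`). [folklore] -/
def slitBall (A : Set ℂ) (p q : ℝ) : Set ℂ := {w | w = 0 ∨ (w ≠ 0 ∧ toSlit p w ∈ slitDomain A p q)}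

/-- `ι ∘ κ = id`. [folklore] -/
theorem ofSlit_toSlit (w : ℂ) : ofSlit p (toSlit p w) = w := by
  simp [ofSlit, toSlit]

/-- `κ ∘ ι = id` off `p`. [folklore] -/
theorem toSlit_ofSlit {z : ℂ} (hz : z ≠ p) : toSlit p (ofSlit p z) = z := by
  have : z - p ≠ 0 := sub_ne_zero.2 hz
  simp [ofSlit, toSlit]

/-- `ι(z) ≠ 0` for `z ≠ p`. [folklore] -/
theorem ofSlit_ne_zero {z : ℂ} (hz : z ≠ p) : ofSlit p z ≠ 0 :=
  inv_ne_zero (sub_ne_zero.2 hz)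

/-- `κ(w) ≠ p` for `w ≠ 0`. [folklore] -/
theorem toSlit_ne {w : ℂ} (hw : w ≠ 0) : toSlit p w ≠ p := by
  simp [toSlit, hw]

/-- `ι` commutes with conjugation (`p` is real). [folklore] -/
theorem ofSlit_conj (z : ℂ) : ofSlit p (conj z) = conj (ofSlit p z) := by
  simp [ofSlit, map_sub, map_inv₀, conj_ofReal]

/-- `κ` commutes with conjugation (`p` is real). [folklore] -/
theorem toSlit_conj (w : ℂ) : toSlit p (conj w) = conj (toSlit p w) := by
  simp [toSlit, map_add, map_inv₀, conj_ofReal]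

/-- `ι` is continuous off `p`. [folklore] -/
theorem continuousOn_ofSlit : ContinuousOn (ofSlit p) {(p : ℂ)}ᶜ := by
  intro z hz
  refine ContinuousAt.continuousWithinAt ?_
  exact (continuousAt_id.sub continuousAt_const).inv₀ (sub_ne_zero.2 hz)

/-- `κ` is continuous off `0`. [folklore] -/
theorem continuousOn_toSlit : ContinuousOn (toSlit p) {(0 : ℂ)}ᶜ := by
  intro w hw
  exact (continuousAt_const.add (continuousAt_inv₀ hw)).continuousWithinAt

/-- `ι'(z) = -(z - p)⁻²`. [folklore] -/
theorem hasDerivAt_ofSlit {z : ℂ} (hz : z ≠ p) :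
    HasDerivAt (ofSlit p) (-((z - p) ^ 2)⁻¹) z := by
  have h := ((hasDerivAt_id' z).sub_const (p : ℂ)).inv (sub_ne_zero.2 hz)
  have h' : (-1 / (z - p) ^ 2 : ℂ) = -((z - p) ^ 2)⁻¹ := by rw [neg_div, one_div]
  rw [h'] at h
  exact h

/-- `ι` is injective off `p`. [folklore] -/
theorem injOn_ofSlit : InjOn (ofSlit p) {(p : ℂ)}ᶜ := fun z hz z' hz' h ↦ by
  have := congrArg (toSlit p) h
  rwa [toSlit_ofSlit hz, toSlit_ofSlit hz'] at this

namespace IsSlitHull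

variable (h : IsSlitHull A p q)
include h

/-- A one-sided hull is compact. [folklore] -/
theorem isCompact_A : IsCompact A := h.isStarHull.isBoundedHull.isCompact

/-- A one-sided hull is closed. [folklore] -/
theorem isClosed_A : IsClosed A := h.isStarHull.isBoundedHull.isClosed

/-- A one-sided hull lies in the closed upper half-plane. [folklore] -/
theorem im_nonneg_of_mem {z : ℂ} (hz : z ∈ A) : 0 ≤ z.im := by
  have := h.isStarHull.isBoundedHull.subset_closure hz
  rwa [show upperHalfPlaneSet = {z : ℂ | 0 < z.im} from rfl, closure_setOf_lt_im] at this

/-- The free endpoint `p` is not in `A`. [folklore] -/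
theorem ofReal_p_notMem : (p : ℂ) ∉ A := fun hp ↦ (h.mem_uIcc p hp).2 rfl

/-- A one-sided hull has real points (no floating pieces). [folklore] -/
theorem exists_ofReal_mem : ∃ x : ℝ, (x : ℂ) ∈ A := by
  by_contra hno
  push Not at hno
  have hAH : A ⊆ upperHalfPlaneSet := fun z hz ↦ by
    rcases (h.im_nonneg_of_mem hz).lt_or_eq with hlt | heq
    · exact hlt
    · exact absurd (show ((z.re : ℝ) : ℂ) ∈ A by
        have : ((z.re : ℝ) : ℂ) = z := Complex.ext (by simp) (by simp [heq])
        rw [this]; exact hz) (hno z.re)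
  have hpre := h.isConnected_union.isPreconnected
  rw [isPreconnected_iff_subset_of_disjoint_closed] at hpre
  have hLc : IsClosed {z : ℂ | z.im ≤ 0} := isClosed_le continuous_im continuous_const
  rcases hpre A {z : ℂ | z.im ≤ 0} h.isClosed_A hLc subset_rfl (by
    rw [← subset_empty_iff]
    rintro z ⟨-, hzA, hzL⟩
    exact absurd (show 0 < z.im from hAH hzA) (not_lt.2 hzL)) with h1 | h1
  · have hmem : (-Complex.I) ∈ A := h1 (Or.inr (by simp))
    have := hAH hmem
    simp only [upperHalfPlaneSet, mem_setOf_eq, neg_im, I_im] at this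
    linarith
  · obtain ⟨a, ha⟩ := h.nonempty
    have ha' : a.im ≤ 0 := h1 (Or.inl ha)
    exact absurd (show 0 < a.im from hAH ha) (not_lt.2 ha')

/-- The slit data are nondegenerate: `p ≠ q`. [folklore] -/
theorem p_ne_q : p ≠ q := by
  obtain ⟨x, hx⟩ := h.exists_ofReal_mem
  obtain ⟨hxI, hxp⟩ := h.mem_uIcc x hx
  rintro rfl
  rw [uIcc_self, mem_singleton_iff] at hxI
  exact hxp hxI

/-! #### The compact set `K` -/

omit h in
/-- `K` is conjugation-invariant. [folklore] -/
theorem conj_mem_slitCompact_iff {z : ℂ} : conj z ∈ slitCompact A p q ↔ z ∈ slitCompact A p q := by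
  simp only [slitCompact, mem_union, mem_setOf_eq, conj_conj, conj_mem_realSeg_iff]
  tauto

/-- `K` is compact. [folklore] -/
theorem isCompact_slitCompact : IsCompact (slitCompact A p q) := by
  refine (h.isCompact_A.union ?_).union isCompact_realSeg
  have : {z : ℂ | conj z ∈ A} = conj '' A := by
    ext z
    refine ⟨fun hz ↦ ⟨conj z, hz, conj_conj z⟩, ?_⟩
    rintro ⟨a, ha, rfl⟩
    simpa using ha
  rw [this]
  exact h.isCompact_A.image continuous_conj

/-- `K` is closed. [folklore] -/
theorem isClosed_slitCompact : IsClosed (slitCompact A p q) := h.isCompact_slitCompact.isClosed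

omit h in
/-- `p ∈ K`. [folklore] -/
theorem ofReal_p_mem_slitCompact : (p : ℂ) ∈ slitCompact A p q :=
  Or.inr (ofReal_mem_realSeg.2 left_mem_uIcc)

/-- The real points of `K` are exactly `[p, q]`. [folklore] -/
theorem ofReal_mem_slitCompact_iff {x : ℝ} : (x : ℂ) ∈ slitCompact A p q ↔ x ∈ uIcc p q := by
  refine ⟨?_, fun hx ↦ Or.inr (ofReal_mem_realSeg.2 hx)⟩
  rintro ((hx | hx) | hx)
  · exact (h.mem_uIcc x hx).1
  · rw [mem_setOf_eq, conj_ofReal] at hx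
    exact (h.mem_uIcc x hx).1
  · exact ofReal_mem_realSeg.1 hx

/-- In the open upper half-plane, `K` is `A`. [folklore] -/
theorem mem_slitCompact_iff_of_im_pos {z : ℂ} (hz : 0 < z.im) : z ∈ slitCompact A p q ↔ z ∈ A := by
  refine ⟨?_, fun hz ↦ Or.inl (Or.inl hz)⟩
  rintro ((h1 | h1) | h1)
  · exact h1
  · have := h.im_nonneg_of_mem h1
    rw [conj_im] at this
    linarith
  · have := im_eq_zero_of_mem_realSeg h1
    linarith

/-- In the open lower half-plane, `K` is `Ā`. [folklore] -/
theorem mem_slitCompact_iff_of_im_neg {z : ℂ} (hz : z.im < 0) :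
    z ∈ slitCompact A p q ↔ conj z ∈ A := by
  rw [← conj_mem_slitCompact_iff, h.mem_slitCompact_iff_of_im_pos (by rw [conj_im]; linarith)]

/-- `0 ∉ K`. [folklore] -/
theorem zero_notMem_slitCompact : (0 : ℂ) ∉ slitCompact A p q := by
  rw [show (0 : ℂ) = ((0 : ℝ) : ℂ) from rfl, h.ofReal_mem_slitCompact_iff]
  exact h.zero_notMem_uIcc

/-! #### The slit domain `Ω` -/

/-- `Ω` is open. [folklore] -/
theorem isOpen_slitDomain : IsOpen (slitDomain A p q) := h.isClosed_slitCompact.isOpen_compl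

/-- `0 ∈ Ω`. [folklore] -/
theorem zero_mem_slitDomain : (0 : ℂ) ∈ slitDomain A p q := h.zero_notMem_slitCompact

omit h in
/-- `p ∉ Ω`. [folklore] -/
theorem ofReal_p_notMem_slitDomain : (p : ℂ) ∉ slitDomain A p q := fun hp ↦ hp ofReal_p_mem_slitCompact

omit h in
/-- Points of `Ω` differ from `p`. [folklore] -/
theorem ne_p_of_mem_slitDomain {z : ℂ} (hz : z ∈ slitDomain A p q) : z ≠ p := fun hzp ↦
  ofReal_p_notMem_slitDomain (hzp ▸ hz)

omit h in
/-- `Ω` is conjugation-invariant. [folklore] -/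
theorem conj_mem_slitDomain_iff {z : ℂ} : conj z ∈ slitDomain A p q ↔ z ∈ slitDomain A p q := by
  simp only [slitDomain, mem_compl_iff, conj_mem_slitCompact_iff]

/-- In the open upper half-plane, `Ω` is `ℍₒ ∖ A`. [folklore] -/
theorem mem_slitDomain_iff_of_im_pos {z : ℂ} (hz : 0 < z.im) : z ∈ slitDomain A p q ↔ z ∉ A := by
  rw [slitDomain, mem_compl_iff, h.mem_slitCompact_iff_of_im_pos hz]

/-- In the open lower half-plane, `Ω` is the reflection of `ℍₒ ∖ A`. [folklore] -/
theorem mem_slitDomain_iff_of_im_neg {z : ℂ} (hz : z.im < 0) :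
    z ∈ slitDomain A p q ↔ conj z ∉ A := by
  rw [slitDomain, mem_compl_iff, h.mem_slitCompact_iff_of_im_neg hz]

/-- The real points of `Ω` are those off `[p, q]`. [folklore] -/
theorem ofReal_mem_slitDomain_iff {x : ℝ} : (x : ℂ) ∈ slitDomain A p q ↔ x ∉ uIcc p q := by
  rw [slitDomain, mem_compl_iff, h.ofReal_mem_slitCompact_iff]

/-- `ℍₒ ∖ A ⊆ Ω`. [folklore] -/
theorem diff_subset_slitDomain : upperHalfPlaneSet \ A ⊆ slitDomain A p q := fun _ hz ↦
  (h.mem_slitDomain_iff_of_im_pos hz.1).2 hz.2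

/-- `Ω ∩ ℍₒ = ℍₒ ∖ A`. [folklore] -/
theorem slitDomain_inter_eq : slitDomain A p q ∩ upperHalfPlaneSet = upperHalfPlaneSet \ A := by
  ext z
  refine ⟨fun ⟨hz, hzH⟩ ↦ ⟨hzH, (h.mem_slitDomain_iff_of_im_pos hzH).1 hz⟩,
    fun hz ↦ ⟨h.diff_subset_slitDomain hz, hz.1⟩⟩

/-- `ℍₒ ∖ A` is connected (it is simply connected). [folklore] -/
theorem isConnected_diff : IsConnected (upperHalfPlaneSet \ A) :=
  h.isStarHull.1.2.2.isPathConnected.isConnected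

/-- `ℍₒ ∖ A` is open. [folklore] -/
theorem isOpen_diff : IsOpen (upperHalfPlaneSet \ A) := isOpen_upperHalfPlaneSet.sdiff h.isClosed_A

/-- `K ∖ {p}` is preconnected: `A ∪ (([p, q]) ∖ {p})` is (replace `{Im ≤ 0}` by the punctured
segment in the connected `A ∪ {Im ≤ 0}`), so is its conjugate, and they share the segment. [folklore] -/
theorem isPreconnected_slitCompact_diff : IsPreconnected (slitCompact A p q \ {(p : ℂ)}) := by
  set S₀ : Set ℂ := (fun x : ℝ ↦ (x : ℂ)) '' (uIcc p q \ {p}) with hS₀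
  have hS₀c : IsPreconnected S₀ :=
    (ordConnected_uIcc_diff.isPreconnected).image _ continuous_ofReal.continuousOn
  have hLc : IsClosed {z : ℂ | z.im ≤ 0} := isClosed_le continuous_im continuous_const
  have hAS : IsPreconnected (A ∪ S₀) := by
    refine IsPreconnected.union_of_inter_subset h.isConnected_union.isPreconnected h.isClosed_A
      hLc ⟨0, by simp⟩ hS₀c ?_
    rintro z ⟨hzA, hzL⟩
    have hz0 : z.im = 0 := le_antisymm hzL (h.im_nonneg_of_mem hzA)
    have hzre : ((z.re : ℝ) : ℂ) = z := Complex.ext (by simp) (by simp [hz0])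
    rw [← hzre] at hzA ⊢
    exact ⟨z.re, ⟨(h.mem_uIcc _ hzA).1, (h.mem_uIcc _ hzA).2⟩, rfl⟩
  have hAS' : IsPreconnected ({z : ℂ | conj z ∈ A} ∪ S₀) := by
    have himg : conj '' (A ∪ S₀) = {z : ℂ | conj z ∈ A} ∪ S₀ := by
      ext z
      constructor
      · rintro ⟨a, ha | ha, rfl⟩
        · exact Or.inl (by simpa using ha)
        · obtain ⟨x, hx, rfl⟩ := ha
          exact Or.inr ⟨x, hx, (conj_ofReal x).symm⟩
      · rintro (hz | hz)
        · exact ⟨conj z, Or.inl hz, conj_conj z⟩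
        · obtain ⟨x, hx, rfl⟩ := hz
          exact ⟨x, Or.inr ⟨x, hx, rfl⟩, conj_ofReal x⟩
    rw [← himg]
    exact hAS.image _ continuous_conj.continuousOn
  have hq : (q : ℂ) ∈ S₀ := ⟨q, ⟨right_mem_uIcc, fun hqp ↦ h.p_ne_q (Eq.symm hqp)⟩, rfl⟩
  have hunion : slitCompact A p q \ {(p : ℂ)} = (A ∪ S₀) ∪ ({z : ℂ | conj z ∈ A} ∪ S₀) := by
    ext z
    simp only [slitCompact, Set.mem_sdiff, mem_union, mem_setOf_eq, mem_singleton_iff]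
    constructor
    · rintro ⟨(hz | hz) | hz, hzp⟩
      · exact Or.inl (Or.inl hz)
      · exact Or.inr (Or.inl hz)
      · obtain ⟨x, hx, rfl⟩ := hz
        refine Or.inl (Or.inr ⟨x, ⟨hx, fun hxp ↦ hzp ?_⟩, rfl⟩)
        rw [show x = p from hxp]
    · rintro ((hz | hz) | (hz | hz))
      · exact ⟨Or.inl (Or.inl hz), fun hzp ↦ h.ofReal_p_notMem (hzp ▸ hz)⟩
      · obtain ⟨x, ⟨hx, hxp⟩, rfl⟩ := hz
        exact ⟨Or.inr ⟨x, hx, rfl⟩, fun hxp' ↦ hxp (ofReal_inj.1 hxp')⟩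
      · refine ⟨Or.inl (Or.inr hz), fun hzp ↦ h.ofReal_p_notMem ?_⟩
        rwa [hzp, conj_ofReal] at hz
      · obtain ⟨x, ⟨hx, hxp⟩, rfl⟩ := hz
        exact ⟨Or.inr ⟨x, hx, rfl⟩, fun hxp' ↦ hxp (ofReal_inj.1 hxp')⟩
  rw [hunion]
  exact hAS.union' ⟨q, Or.inr hq, Or.inr hq⟩ hAS'

/-- `K ∖ {p}` is nonempty (it contains `q`). [folklore] -/
theorem slitCompact_diff_nonempty : (slitCompact A p q \ {(p : ℂ)}).Nonempty :=
  ⟨q, Or.inr (ofReal_mem_realSeg.2 right_mem_uIcc), fun hqp ↦ h.p_ne_q (ofReal_inj.1 hqp).symm⟩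

/-- The slit domain `Ω` is connected. [folklore] -/
theorem isConnected_slitDomain : IsConnected (slitDomain A p q) := by
  have hU := h.isConnected_diff
  set U := upperHalfPlaneSet \ A with hUdef
  set U' : Set ℂ := {z | conj z ∈ U} with hU'def
  have hU' : IsPreconnected U' := by
    have : U' = conj '' U := by
      ext z
      refine ⟨fun hz ↦ ⟨conj z, hz, conj_conj z⟩, ?_⟩
      rintro ⟨a, ha, rfl⟩
      simpa [hU'def] using ha
    rw [this]
    exact hU.isPreconnected.image _ continuous_conj.continuousOn
  -- real points of `Ω` with balls around them inside `Ω`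
  have hball : ∀ x : {x : ℝ // x ∉ uIcc p q}, ∃ r > 0, ball ((x : ℝ) : ℂ) r ⊆ slitDomain A p q :=
    fun x ↦ Metric.isOpen_iff.1 h.isOpen_slitDomain _ ((h.ofReal_mem_slitDomain_iff).2 x.2)
  choose r hr hrΩ using hball
  obtain ⟨z₀, hz₀⟩ := hU.nonempty
  have hUΩ : U ⊆ slitDomain A p q := h.diff_subset_slitDomain
  have hU'Ω : U' ⊆ slitDomain A p q := fun z hz ↦
    conj_mem_slitDomain_iff.1 (hUΩ hz)
  have hpiece : ∀ x : {x : ℝ // x ∉ uIcc p q},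
      IsPreconnected (U ∪ ball ((x : ℝ) : ℂ) (r x) ∪ U') := fun x ↦ by
    have h1 : ((x : ℝ) : ℂ) + (r x / 2 : ℝ) * Complex.I ∈ ball ((x : ℝ) : ℂ) (r x) := by
      rw [mem_ball, dist_eq_norm]
      have : ((x : ℝ) : ℂ) + (r x / 2 : ℝ) * Complex.I - (x : ℝ) = (r x / 2 : ℝ) * Complex.I := by ring
      rw [this, norm_mul, norm_real, Complex.norm_I, mul_one, Real.norm_of_nonneg (by linarith [hr x])]
      linarith [hr x]
    have h1U : ((x : ℝ) : ℂ) + (r x / 2 : ℝ) * Complex.I ∈ U := by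
      have him : 0 < (((x : ℝ) : ℂ) + (r x / 2 : ℝ) * Complex.I).im := by
        simp; linarith [hr x]
      exact ⟨him, (h.mem_slitDomain_iff_of_im_pos him).1 (hrΩ x h1)⟩
    have h2 : ((x : ℝ) : ℂ) - (r x / 2 : ℝ) * Complex.I ∈ ball ((x : ℝ) : ℂ) (r x) := by
      rw [mem_ball, dist_eq_norm]
      have : ((x : ℝ) : ℂ) - (r x / 2 : ℝ) * Complex.I - (x : ℝ) = -((r x / 2 : ℝ) * Complex.I) := by ring
      rw [this, norm_neg, norm_mul, norm_real, Complex.norm_I, mul_one,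
        Real.norm_of_nonneg (by linarith [hr x])]
      linarith [hr x]
    have h2U' : ((x : ℝ) : ℂ) - (r x / 2 : ℝ) * Complex.I ∈ U' := by
      show conj _ ∈ U
      have : conj (((x : ℝ) : ℂ) - (r x / 2 : ℝ) * Complex.I) = ((x : ℝ) : ℂ) + (r x / 2 : ℝ) * Complex.I := by
        simp only [map_sub, map_mul, conj_ofReal, conj_I]
        ring
      rw [this]
      exact h1U
    refine (hU.isPreconnected.union' ⟨_, h1U, h1⟩ (convex_ball _ _).isPreconnected).union'
      ⟨_, Or.inr h2, h2U'⟩ hU'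
  have hcover : slitDomain A p q = ⋃ x : {x : ℝ // x ∉ uIcc p q}, (U ∪ ball ((x : ℝ) : ℂ) (r x) ∪ U') := by
    apply subset_antisymm
    · intro z hz
      rw [mem_iUnion]
      rcases lt_trichotomy z.im 0 with hlt | heq | hgt
      · exact ⟨⟨0, h.zero_notMem_uIcc⟩, Or.inr ⟨show 0 < (conj z).im by rw [conj_im]; linarith,
          (h.mem_slitDomain_iff_of_im_neg hlt).1 hz⟩⟩
      · have hzre : ((z.re : ℝ) : ℂ) = z := Complex.ext (by simp) (by simp [heq])
        have hx : z.re ∉ uIcc p q := (h.ofReal_mem_slitDomain_iff).1 (by rw [hzre]; exact hz)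
        refine ⟨⟨z.re, hx⟩, Or.inl (Or.inr ?_)⟩
        show z ∈ ball (((z.re : ℝ)) : ℂ) _
        rw [mem_ball, dist_eq_zero.2 hzre.symm]
        exact hr _
      · exact ⟨⟨0, h.zero_notMem_uIcc⟩, Or.inl (Or.inl ⟨hgt, (h.mem_slitDomain_iff_of_im_pos hgt).1 hz⟩)⟩
    · intro z hz
      rw [mem_iUnion] at hz
      obtain ⟨x, (hz | hz) | hz⟩ := hz
      · exact hUΩ hz
      · exact hrΩ x hz
      · exact hU'Ω hz
  refine ⟨⟨0, h.zero_mem_slitDomain⟩, ?_⟩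
  rw [hcover]
  exact isPreconnected_iUnion ⟨z₀, mem_iInter.2 fun x ↦ Or.inl (Or.inl hz₀)⟩ hpiece

/-! #### The inverted domain `G` -/

omit h in
/-- `ι(Ω) ⊆ G`. [folklore] -/
theorem ofSlit_mem_slitBall {z : ℂ} (hz : z ∈ slitDomain A p q) : ofSlit p z ∈ slitBall A p q :=
  Or.inr ⟨ofSlit_ne_zero (ne_p_of_mem_slitDomain hz), by rwa [toSlit_ofSlit (ne_p_of_mem_slitDomain hz)]⟩

omit h in
/-- `0 ∈ G` (the image of `∞`). [folklore] -/
theorem zero_mem_slitBall : (0 : ℂ) ∈ slitBall A p q := Or.inl rfl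

omit h in
/-- `G` is conjugation-invariant. [folklore] -/
theorem conj_mem_slitBall_iff {w : ℂ} : conj w ∈ slitBall A p q ↔ w ∈ slitBall A p q := by
  simp only [slitBall, mem_setOf_eq, map_eq_zero, toSlit_conj, conj_mem_slitDomain_iff, ne_eq]

/-- A radius `R > 0` with `K ⊆ closedBall p R`. [folklore] -/
theorem exists_slitCompact_subset_closedBall : ∃ R > 0, slitCompact A p q ⊆ closedBall (p : ℂ) R := by
  obtain ⟨R, hR⟩ := h.isCompact_slitCompact.isBounded.subset_closedBall (p : ℂ)
  refine ⟨max R 1, by positivity, hR.trans (closedBall_subset_closedBall (le_max_left _ _))⟩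

omit h in
/-- Small nonzero `w` have `κ(w) ∈ Ω` (when `K ⊆ B̄(p, R)` and `|w| < R⁻¹`). [folklore] -/
theorem toSlit_mem_slitDomain_of_norm_lt {R : ℝ} (hR : 0 < R)
    (hK : slitCompact A p q ⊆ closedBall (p : ℂ) R) {w : ℂ} (hw0 : w ≠ 0) (hw : ‖w‖ < R⁻¹) :
    toSlit p w ∈ slitDomain A p q := by
  intro hwK
  have h1 := hK hwK
  rw [mem_closedBall, dist_eq_norm, toSlit, add_sub_cancel_left, norm_inv] at h1
  have h2 : R < ‖w‖⁻¹ := (lt_inv_comm₀ (norm_pos_iff.2 hw0) hR).1 hw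
  linarith

omit h in
/-- `B(0, R⁻¹) ⊆ G` when `K ⊆ B̄(p, R)`. [folklore] -/
theorem ball_subset_slitBall {R : ℝ} (hR : 0 < R) (hK : slitCompact A p q ⊆ closedBall (p : ℂ) R) :
    ball (0 : ℂ) R⁻¹ ⊆ slitBall A p q := fun w hw ↦ by
  by_cases hw0 : w = 0
  · exact Or.inl hw0
  · exact Or.inr ⟨hw0, toSlit_mem_slitDomain_of_norm_lt hR hK hw0 (mem_ball_zero_iff.1 hw)⟩

/-- `G` is open. [folklore] -/
theorem isOpen_slitBall : IsOpen (slitBall A p q) := by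
  obtain ⟨R, hR, hK⟩ := h.exists_slitCompact_subset_closedBall
  have hopen : IsOpen ({(0 : ℂ)}ᶜ ∩ toSlit p ⁻¹' slitDomain A p q) :=
    continuousOn_toSlit.isOpen_inter_preimage isOpen_compl_singleton h.isOpen_slitDomain
  rw [isOpen_iff_mem_nhds]
  intro w hw
  rcases hw with hw | ⟨hw0, hwΩ⟩
  · rw [hw]
    exact Filter.mem_of_superset (ball_mem_nhds _ (inv_pos.2 hR)) (ball_subset_slitBall hR hK)
  · exact Filter.mem_of_superset (hopen.mem_nhds ⟨hw0, hwΩ⟩) fun w' hw' ↦ Or.inr ⟨hw'.1, hw'.2⟩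

omit h in
/-- `ℂ ∖ G = ι(K ∖ {p})`. [folklore] -/
theorem compl_slitBall_eq : (slitBall A p q)ᶜ = ofSlit p '' (slitCompact A p q \ {(p : ℂ)}) := by
  ext w
  simp only [slitBall, mem_compl_iff, mem_setOf_eq, not_or, not_and, slitDomain, not_not]
  constructor
  · rintro ⟨hw0, hwK⟩
    exact ⟨toSlit p w, ⟨hwK hw0, toSlit_ne hw0⟩, ofSlit_toSlit _⟩
  · rintro ⟨z, ⟨hzK, hzp⟩, rfl⟩
    exact ⟨ofSlit_ne_zero hzp, fun _ ↦ by rwa [toSlit_ofSlit hzp]⟩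

/-- `ℂ ∖ G` is preconnected. [folklore] -/
theorem isPreconnected_compl_slitBall : IsPreconnected (slitBall A p q)ᶜ := by
  rw [compl_slitBall_eq]
  exact h.isPreconnected_slitCompact_diff.image _ (continuousOn_ofSlit.mono fun z hz ↦ hz.2)

/-- `ℂ ∖ G` is unbounded (`ι(z) → ∞` as `z → p` along `K`). [folklore] -/
theorem not_isBounded_compl_slitBall : ¬ IsBounded (slitBall A p q)ᶜ := by
  intro hb
  obtain ⟨M, hM⟩ := hb.subset_closedBall 0
  have hM0 : 0 ≤ M := by
    obtain ⟨z, hz⟩ := h.slitCompact_diff_nonempty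
    have : ofSlit p z ∈ (slitBall A p q)ᶜ := by rw [compl_slitBall_eq]; exact ⟨z, hz, rfl⟩
    have := hM this
    rw [mem_closedBall, dist_zero_right] at this
    exact (norm_nonneg _).trans this
  -- a point of `K ∖ {p}` very close to `p`
  have hqp : 0 < |q - p| := abs_pos.2 (sub_ne_zero.2 (Ne.symm h.p_ne_q))
  set t : ℝ := min 1 (1 / (2 * (M + 1) * |q - p|)) with ht
  have ht0 : 0 < t := lt_min one_pos (by positivity)
  have ht1 : t ≤ 1 := min_le_left _ _
  set x : ℝ := p + t * (q - p) with hx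
  have hxI : x ∈ uIcc p q := add_mul_sub_mem_uIcc ht0.le ht1
  have hxp : x ≠ p := by
    rw [hx]
    intro hxp
    have : t * (q - p) = 0 := by linarith
    rcases mul_eq_zero.1 this with h0 | h0
    · exact ht0.ne' h0
    · exact h.p_ne_q (by linarith)
  have hxK : (x : ℂ) ∈ slitCompact A p q \ {(p : ℂ)} :=
    ⟨Or.inr (ofReal_mem_realSeg.2 hxI), fun hxp' ↦ hxp (ofReal_inj.1 hxp')⟩
  have hmem : ofSlit p x ∈ (slitBall A p q)ᶜ := by rw [compl_slitBall_eq]; exact ⟨x, hxK, rfl⟩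
  have hle := hM hmem
  rw [mem_closedBall, dist_zero_right, ofSlit, norm_inv, ← ofReal_sub, norm_real, Real.norm_eq_abs] at hle
  have hxp' : |x - p| = t * |q - p| := by
    rw [hx, add_sub_cancel_left, abs_mul, abs_of_pos ht0]
  rw [hxp'] at hle
  have hsmall : t * |q - p| ≤ 1 / (2 * (M + 1)) := by
    calc t * |q - p| ≤ (1 / (2 * (M + 1) * |q - p|)) * |q - p| :=
          mul_le_mul_of_nonneg_right (min_le_right _ _) hqp.le
      _ = 1 / (2 * (M + 1)) := by field_simp
  have hpos : 0 < t * |q - p| := mul_pos ht0 hqp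
  have : 2 * (M + 1) ≤ (t * |q - p|)⁻¹ := by
    rw [le_inv_comm₀ (by positivity) hpos]
    simpa [one_div] using hsmall
  linarith

/-- `G ≠ ℂ`. [folklore] -/
theorem slitBall_ne_univ : slitBall A p q ≠ univ := fun huniv ↦ by
  have := h.not_isBounded_compl_slitBall
  rw [huniv, compl_univ] at this
  exact this isBounded_empty

/-- `G` is connected (`ι(Ω)` is, and accumulates at `0`). [folklore] -/
theorem isConnected_slitBall : IsConnected (slitBall A p q) := by
  refine ⟨⟨0, zero_mem_slitBall⟩, ?_⟩
  have himg : IsPreconnected (ofSlit p '' slitDomain A p q) :=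
    h.isConnected_slitDomain.isPreconnected.image _
      (continuousOn_ofSlit.mono fun z hz ↦ ne_p_of_mem_slitDomain hz)
  refine himg.subset_closure (by rintro _ ⟨z, hz, rfl⟩; exact ofSlit_mem_slitBall hz) ?_
  intro w hw
  rcases hw with hw | ⟨hw0, hwΩ⟩
  · -- `0` is a limit of `ι(Ω) ⊇ ball 0 R⁻¹ ∖ {0}`
    obtain ⟨R, hR, hK⟩ := h.exists_slitCompact_subset_closedBall
    rw [hw]
    have hsub : ball (0 : ℂ) R⁻¹ ∩ {(0 : ℂ)}ᶜ ⊆ ofSlit p '' slitDomain A p q := fun w' ⟨hw', hw'0⟩ ↦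
      ⟨toSlit p w', toSlit_mem_slitDomain_of_norm_lt hR hK hw'0 (mem_ball_zero_iff.1 hw'),
        ofSlit_toSlit _⟩
    refine closure_mono hsub ?_
    rw [mem_closure_iff_nhdsWithin_neBot, nhdsWithin_inter_of_mem]
    · infer_instance
    · exact mem_nhdsWithin_of_mem_nhds (ball_mem_nhds _ (inv_pos.2 hR))
  · exact subset_closure ⟨toSlit p w, hwΩ, ofSlit_toSlit _⟩

/-- **The inverted symmetrized domain is simply connected**: its complement `ι(K ∖ {p})` is
connected and unbounded (`Complex.isSimplyConnected_of_compl`, Conway VIII.2.2). [folklore] -/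
theorem isSimplyConnected_slitBall : IsSimplyConnected (slitBall A p q) :=
  Complex.isSimplyConnected_of_compl h.isOpen_slitBall h.isConnected_slitBall fun _ ha hb ↦
    h.not_isBounded_compl_slitBall
      (hb.subset (h.isPreconnected_compl_slitBall.subset_connectedComponentIn ha subset_rfl))

/-! #### The symmetric Riemann map `f` of `G` and `F = f ∘ ι` -/

/-- The symmetric normalized Riemann map `f : G → 𝔻` (`f(0) = 0`, `f'(0) > 0`,
`f(z̄) = conj f(z)`). [folklore] -/
def riemannMap : ConformalEquiv (slitBall A p q) (ball (0 : ℂ) 1) :=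
  Classical.choose (exists_symmetric_riemannMap h.isOpen_slitBall h.isSimplyConnected_slitBall
    h.slitBall_ne_univ zero_mem_slitBall (fun _ hw ↦ conj_mem_slitBall_iff.2 hw))

/-- The defining properties of the symmetric Riemann map. [folklore] -/
theorem riemannMap_spec : h.riemannMap 0 = 0 ∧ 0 < (deriv h.riemannMap 0).re ∧
    (deriv h.riemannMap 0).im = 0 ∧
    ∀ z ∈ slitBall A p q, h.riemannMap (conj z) = conj (h.riemannMap z) :=
  Classical.choose_spec (exists_symmetric_riemannMap h.isOpen_slitBall h.isSimplyConnected_slitBall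
    h.slitBall_ne_univ zero_mem_slitBall (fun _ hw ↦ conj_mem_slitBall_iff.2 hw))

/-- The scaling constant `c = f'(0) > 0`. [folklore] -/
def derivConst : ℝ := (deriv h.riemannMap 0).re

/-- `c = f'(0) > 0`. [folklore] -/
theorem derivConst_pos : 0 < h.derivConst := h.riemannMap_spec.2.1

/-- `f'(0) = c`. [folklore] -/
theorem deriv_riemannMap_zero : deriv h.riemannMap 0 = (h.derivConst : ℂ) :=
  Complex.ext (by simp [derivConst]) (by simp [h.riemannMap_spec.2.2.1])

/-- `f(0) = 0`. [folklore] -/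
theorem riemannMap_zero : h.riemannMap 0 = 0 := h.riemannMap_spec.1

/-- `f` commutes with conjugation. [folklore] -/
theorem riemannMap_conj {w : ℂ} (hw : w ∈ slitBall A p q) :
    h.riemannMap (conj w) = conj (h.riemannMap w) := h.riemannMap_spec.2.2.2 w hw

/-- `f` is holomorphic on `G`. [folklore] -/
theorem differentiableAt_riemannMap {w : ℂ} (hw : w ∈ slitBall A p q) :
    DifferentiableAt ℂ h.riemannMap w :=
  h.riemannMap.differentiableOn_coe.differentiableAt (h.isOpen_slitBall.mem_nhds hw)

/-- `f` has derivative `c` at `0`. [folklore] -/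
theorem hasDerivAt_riemannMap_zero : HasDerivAt h.riemannMap (h.derivConst : ℂ) 0 := by
  rw [← h.deriv_riemannMap_zero]
  exact (h.differentiableAt_riemannMap zero_mem_slitBall).hasDerivAt

/-- `f' ≠ 0` on `G`. [folklore] -/
theorem deriv_riemannMap_ne_zero {w : ℂ} (hw : w ∈ slitBall A p q) : deriv h.riemannMap w ≠ 0 :=
  ConformalEquiv.deriv_ne_zero_holds h.riemannMap h.isOpen_slitBall hw

/-- `f ≠ 0` off `0`. [folklore] -/
theorem riemannMap_ne_zero {w : ℂ} (hw : w ∈ slitBall A p q) (hw0 : w ≠ 0) : h.riemannMap w ≠ 0 := by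
  intro h0
  have heq : h.riemannMap w = h.riemannMap 0 := by rw [h0, h.riemannMap_zero]
  exact hw0 (h.riemannMap.injOn hw zero_mem_slitBall heq)

/-- `F = f ∘ ι` on `Ω`. [folklore] -/
def mapF (z : ℂ) : ℂ := h.riemannMap (ofSlit p z)

/-- Unfolding `F`. [folklore] -/
theorem mapF_def (z : ℂ) : h.mapF z = h.riemannMap (ofSlit p z) := rfl

omit h in
/-- `ι(z) ∈ G` for `z ∈ Ω`. [folklore] -/
theorem ofSlit_mem {z : ℂ} (hz : z ∈ slitDomain A p q) : ofSlit p z ∈ slitBall A p q :=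
  ofSlit_mem_slitBall hz

/-- `F(Ω) ⊆ 𝔻`. [folklore] -/
theorem mapF_mem_ball {z : ℂ} (hz : z ∈ slitDomain A p q) : h.mapF z ∈ ball (0 : ℂ) 1 :=
  h.riemannMap.mapsTo (ofSlit_mem hz)

/-- `|F| < 1` on `Ω`. [folklore] -/
theorem norm_mapF_lt_one {z : ℂ} (hz : z ∈ slitDomain A p q) : ‖h.mapF z‖ < 1 :=
  mem_ball_zero_iff.1 (h.mapF_mem_ball hz)

/-- `F ≠ 0` on `Ω`. [folklore] -/
theorem mapF_ne_zero {z : ℂ} (hz : z ∈ slitDomain A p q) : h.mapF z ≠ 0 :=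
  h.riemannMap_ne_zero (ofSlit_mem hz) (ofSlit_ne_zero (ne_p_of_mem_slitDomain hz))

/-- `F` commutes with conjugation on `Ω`. [folklore] -/
theorem mapF_conj {z : ℂ} (hz : z ∈ slitDomain A p q) : h.mapF (conj z) = conj (h.mapF z) := by
  rw [mapF_def, mapF_def, ofSlit_conj, h.riemannMap_conj (ofSlit_mem hz)]

/-- The derivative of `F = f ∘ ι` (chain rule). [folklore] -/
theorem hasDerivAt_mapF {z : ℂ} (hz : z ∈ slitDomain A p q) :
    HasDerivAt h.mapF (deriv h.riemannMap (ofSlit p z) * -((z - p) ^ 2)⁻¹) z :=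
  (h.differentiableAt_riemannMap (ofSlit_mem hz)).hasDerivAt.comp z
    (hasDerivAt_ofSlit (ne_p_of_mem_slitDomain hz))

/-- `F` is holomorphic on `Ω`. [folklore] -/
theorem differentiableAt_mapF {z : ℂ} (hz : z ∈ slitDomain A p q) : DifferentiableAt ℂ h.mapF z :=
  (h.hasDerivAt_mapF hz).differentiableAt

/-- `F' ≠ 0` on `Ω`. [folklore] -/
theorem deriv_mapF_ne_zero {z : ℂ} (hz : z ∈ slitDomain A p q) : deriv h.mapF z ≠ 0 := by
  rw [(h.hasDerivAt_mapF hz).deriv]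
  exact mul_ne_zero (h.deriv_riemannMap_ne_zero (ofSlit_mem hz))
    (neg_ne_zero.2 (inv_ne_zero (pow_ne_zero 2 (sub_ne_zero.2 (ne_p_of_mem_slitDomain hz)))))

/-- `F` is continuous on `Ω`. [folklore] -/
theorem continuousOn_mapF : ContinuousOn h.mapF (slitDomain A p q) := fun _ hz ↦
  (h.differentiableAt_mapF hz).continuousAt.continuousWithinAt

/-- `F` is injective on `Ω`. [folklore] -/
theorem injOn_mapF : InjOn h.mapF (slitDomain A p q) := fun _ hz _ hz' heq ↦
  injOn_ofSlit (ne_p_of_mem_slitDomain hz) (ne_p_of_mem_slitDomain hz')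
    (h.riemannMap.injOn (ofSlit_mem hz) (ofSlit_mem hz') heq)

/-- `F` is real exactly on the real points of `Ω`. [folklore] -/
theorem mapF_im_eq_zero_iff {z : ℂ} (hz : z ∈ slitDomain A p q) : (h.mapF z).im = 0 ↔ z.im = 0 := by
  rw [← conj_eq_iff_im, ← conj_eq_iff_im, ← h.mapF_conj hz]
  refine ⟨fun heq ↦ h.injOn_mapF (conj_mem_slitDomain_iff.2 hz) hz heq, fun heq ↦ by rw [heq]⟩

/-- `F(0)` is real. [folklore] -/
theorem mapF_zero_im : (h.mapF 0).im = 0 := (h.mapF_im_eq_zero_iff h.zero_mem_slitDomain).2 rfl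

/-- Far up the vertical line through `p`, `F` has negative imaginary part (`f(w) ≈ f'(0) w` at
`w = (iy)⁻¹`). [folklore] -/
theorem exists_mapF_im_neg : ∃ z ∈ upperHalfPlaneSet \ A, (h.mapF z).im < 0 := by
  -- the path `t y = (y i)⁻¹ → 0`
  set t : ℝ → ℂ := fun y ↦ ((y : ℂ) * I)⁻¹ with ht
  have ht0 : Tendsto t atTop (𝓝[≠] 0) := by
    refine tendsto_nhdsWithin_iff.2 ⟨?_, ?_⟩
    · rw [tendsto_zero_iff_norm_tendsto_zero]
      have : (fun y : ℝ ↦ ‖t y‖) =ᶠ[atTop] fun y ↦ y⁻¹ := by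
        filter_upwards [eventually_gt_atTop 0] with y hy
        rw [ht]
        simp [norm_inv, abs_of_pos hy]
      rw [tendsto_congr' this]
      exact tendsto_inv_atTop_zero
    · filter_upwards [eventually_gt_atTop 0] with y hy
      rw [ht]
      simp [hy.ne']
  have hslope := h.hasDerivAt_riemannMap_zero.tendsto_slope_zero
  simp only [zero_add, h.riemannMap_zero, sub_zero, smul_eq_mul] at hslope
  have hcomp := hslope.comp ht0
  have hre : Tendsto (fun y ↦ ((t y)⁻¹ * h.riemannMap (t y)).re) atTop (𝓝 h.derivConst) := by
    have := (continuous_re.tendsto _).comp hcomp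
    rw [ofReal_re] at this
    exact this
  have hev := (tendsto_order.1 hre).1 0 h.derivConst_pos
  -- also eventually `p + y i ∉ A`
  obtain ⟨R, hR⟩ := h.isCompact_A.isBounded.subset_closedBall (p : ℂ)
  obtain ⟨y, hy, hy0, hyR⟩ := (hev.and ((eventually_gt_atTop 0).and (eventually_gt_atTop R))).exists
  refine ⟨(p : ℂ) + y * I, ⟨?_, fun hA ↦ ?_⟩, ?_⟩
  · show 0 < ((p : ℂ) + y * I).im
    simpa using hy0
  · have := hR hA
    rw [mem_closedBall, dist_eq_norm, add_sub_cancel_left, norm_mul, norm_real, norm_I, mul_one,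
      Real.norm_of_nonneg hy0.le] at this
    linarith
  · have hF : h.mapF ((p : ℂ) + y * I) = h.riemannMap (t y) := by
      rw [mapF_def, ofSlit, add_sub_cancel_left]
    rw [hF]
    have hty : (t y)⁻¹ = (y : ℂ) * I := by rw [ht, inv_inv]
    rw [hty] at hy
    have hre' : (((y : ℂ) * I) * h.riemannMap (t y)).re = -(y * (h.riemannMap (t y)).im) := by
      simp [mul_re, mul_im]
    rw [hre'] at hy
    nlinarith

/-- `F` maps `ℍₒ ∖ A` into the lower half-disc. [folklore] -/
theorem mapsTo_mapF : MapsTo h.mapF (upperHalfPlaneSet \ A) lowerHalfDisc := by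
  have hconn : IsPreconnected (h.mapF '' (upperHalfPlaneSet \ A)) :=
    h.isConnected_diff.isPreconnected.image _ (h.continuousOn_mapF.mono h.diff_subset_slitDomain)
  have hsub : h.mapF '' (upperHalfPlaneSet \ A) ⊆ {w : ℂ | w.im < 0} ∪ {w : ℂ | 0 < w.im} := by
    rintro _ ⟨z, hz, rfl⟩
    have hne : (h.mapF z).im ≠ 0 := fun h0 ↦
      (ne_of_gt hz.1) ((h.mapF_im_eq_zero_iff (h.diff_subset_slitDomain hz)).1 h0)
    rcases hne.lt_or_gt with hlt | hgt
    · exact Or.inl hlt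
    · exact Or.inr hgt
  have hdisj : Disjoint {w : ℂ | w.im < 0} {w : ℂ | 0 < w.im} :=
    Set.disjoint_left.2 fun w hw hw' ↦ by simp only [mem_setOf_eq] at hw hw'; linarith
  rcases hconn.subset_or_subset (isOpen_lt continuous_im continuous_const)
    (isOpen_lt continuous_const continuous_im) hdisj hsub with hneg | hpos
  · exact fun z hz ↦ ⟨h.norm_mapF_lt_one (h.diff_subset_slitDomain hz), hneg ⟨z, hz, rfl⟩⟩
  · exfalso
    obtain ⟨z, hz, hzim⟩ := h.exists_mapF_im_neg
    have := hpos ⟨z, hz, rfl⟩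
    simp only [mem_setOf_eq] at this
    linarith

/-- `F` maps `ℍₒ ∖ A` ONTO the lower half-disc. [folklore] -/
theorem surjOn_mapF : SurjOn h.mapF (upperHalfPlaneSet \ A) lowerHalfDisc := by
  intro w hw
  have hwb : w ∈ ball (0 : ℂ) 1 := mem_ball_zero_iff.2 hw.1
  have hw0 : w ≠ 0 := fun h0 ↦ by
    have := hw.2
    rw [h0, zero_im] at this
    exact lt_irrefl _ this
  set v := h.riemannMap.symm w with hv
  have hvG : v ∈ slitBall A p q := h.riemannMap.symm_mapsTo hwb
  have hfv : h.riemannMap v = w := h.riemannMap.apply_symm_apply hwb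
  have hv0 : v ≠ 0 := fun h0 ↦ hw0 (by rw [← hfv, h0, h.riemannMap_zero])
  have hzΩ : toSlit p v ∈ slitDomain A p q := (hvG.resolve_left hv0).2
  set z := toSlit p v with hz
  have hFz : h.mapF z = w := by rw [mapF_def, hz, ofSlit_toSlit, hfv]
  refine ⟨z, ?_, hFz⟩
  rcases lt_trichotomy z.im 0 with hlt | heq | hgt
  · exfalso
    have hcz : conj z ∈ upperHalfPlaneSet \ A := by
      rw [← h.slitDomain_inter_eq]
      exact ⟨conj_mem_slitDomain_iff.2 hzΩ, show 0 < (conj z).im by rw [conj_im]; linarith⟩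
    have := (h.mapsTo_mapF hcz).2
    rw [h.mapF_conj hzΩ, conj_im, hFz] at this
    linarith [hw.2]
  · exfalso
    have := (h.mapF_im_eq_zero_iff hzΩ).2 heq
    rw [hFz] at this
    exact absurd this hw.2.ne
  · exact ⟨hgt, (h.mem_slitDomain_iff_of_im_pos hgt).1 hzΩ⟩

/-- `F` maps `ℍₒ ∖ A` bijectively onto the lower half-disc. [folklore] -/
theorem bijOn_mapF : BijOn h.mapF (upperHalfPlaneSet \ A) lowerHalfDisc :=
  ⟨h.mapsTo_mapF, h.injOn_mapF.mono h.diff_subset_slitDomain, h.surjOn_mapF⟩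

/-! #### The extension `E = c · (J ∘ F - J(F(0)))` and the restriction map `Φ_A = E|` -/

/-- The real number `J(F(0))`. [folklore] -/
def joukowskiZero : ℝ := (joukowski (h.mapF 0)).re

/-- `J(F(0))` is the real number `joukowskiZero`. [folklore] -/
theorem joukowski_mapF_zero : joukowski (h.mapF 0) = (h.joukowskiZero : ℂ) := by
  refine Complex.ext (by simp [joukowskiZero]) ?_
  rw [ofReal_im, ← conj_eq_iff_im, ← joukowski_conj, conj_eq_iff_im.2 h.mapF_zero_im]

/-- **The symmetric extension `E` of `Φ_A`** to the slit domain `Ω`: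
`E = f'(0) · (J ∘ F - J(F(0)))`. [folklore] -/
def ext (z : ℂ) : ℂ := h.derivConst * (joukowski (h.mapF z) - h.joukowskiZero)

/-- Unfolding `E`. [folklore] -/
theorem ext_def (z : ℂ) : h.ext z = h.derivConst * (joukowski (h.mapF z) - h.joukowskiZero) := rfl

/-- `E(0) = 0`. [folklore] -/
theorem ext_zero : h.ext 0 = 0 := by
  rw [ext_def, h.joukowski_mapF_zero, sub_self, mul_zero]

/-- The derivative of `E` (chain rule). [folklore] -/
theorem hasDerivAt_ext {z : ℂ} (hz : z ∈ slitDomain A p q) :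
    HasDerivAt h.ext (h.derivConst * (deriv joukowski (h.mapF z) * deriv h.mapF z)) z := by
  have hJ := (hasDerivAt_joukowski (h.mapF_ne_zero hz)).comp z (h.differentiableAt_mapF hz).hasDerivAt
  rw [← deriv_joukowski (h.mapF_ne_zero hz)] at hJ
  have := (hJ.sub_const (h.joukowskiZero : ℂ)).const_mul (h.derivConst : ℂ)
  exact this

/-- `E` is holomorphic on `Ω`. [folklore] -/
theorem differentiableAt_ext {z : ℂ} (hz : z ∈ slitDomain A p q) : DifferentiableAt ℂ h.ext z :=
  (h.hasDerivAt_ext hz).differentiableAt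

/-- `E` is holomorphic on `Ω`. [folklore] -/
theorem differentiableOn_ext : DifferentiableOn ℂ h.ext (slitDomain A p q) := fun _ hz ↦
  (h.differentiableAt_ext hz).differentiableWithinAt

/-- `E` is continuous on `Ω`. [folklore] -/
theorem continuousOn_ext : ContinuousOn h.ext (slitDomain A p q) := h.differentiableOn_ext.continuousOn

/-- `E' ≠ 0` on `Ω`. [folklore] -/
theorem deriv_ext_ne_zero {z : ℂ} (hz : z ∈ slitDomain A p q) : deriv h.ext z ≠ 0 := by
  rw [(h.hasDerivAt_ext hz).deriv]
  refine mul_ne_zero (ofReal_ne_zero.2 h.derivConst_pos.ne') (mul_ne_zero ?_ (h.deriv_mapF_ne_zero hz))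
  exact deriv_joukowski_ne_zero (h.norm_mapF_lt_one hz) (h.mapF_ne_zero hz)

/-- `E` commutes with conjugation on `Ω`. [folklore] -/
theorem ext_conj {z : ℂ} (hz : z ∈ slitDomain A p q) : h.ext (conj z) = conj (h.ext z) := by
  rw [ext_def, ext_def, h.mapF_conj hz, joukowski_conj, map_mul, conj_ofReal, map_sub, conj_ofReal]

/-- `E` is real on the real points of `Ω`. [folklore] -/
theorem ext_ofReal_im {x : ℝ} (hx : (x : ℂ) ∈ slitDomain A p q) : (h.ext x).im = 0 := by
  rw [← conj_eq_iff_im, ← h.ext_conj hx, conj_ofReal]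

/-- `E` is injective on `Ω`. [folklore] -/
theorem injOn_ext : InjOn h.ext (slitDomain A p q) := by
  intro z hz z' hz' heq
  rw [ext_def, ext_def] at heq
  have h1 := mul_left_cancel₀ (ofReal_ne_zero.2 h.derivConst_pos.ne') heq
  have h2 : joukowski (h.mapF z) = joukowski (h.mapF z') := sub_left_injective h1
  exact h.injOn_mapF hz hz' (injOn_joukowski ⟨h.mapF_mem_ball hz, h.mapF_ne_zero hz⟩
    ⟨h.mapF_mem_ball hz', h.mapF_ne_zero hz'⟩ h2)

/-- `im E = c · im (J ∘ F)`. [folklore] -/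
theorem ext_im (z : ℂ) : (h.ext z).im = h.derivConst * (joukowski (h.mapF z)).im := by
  rw [ext_def, mul_im, ofReal_re, ofReal_im, zero_mul, add_zero, sub_im, ofReal_im, sub_zero]

/-- `E` maps `ℍₒ ∖ A` into `ℍₒ`. [folklore] -/
theorem mapsTo_ext : MapsTo h.ext (upperHalfPlaneSet \ A) upperHalfPlaneSet := fun z hz ↦ by
  show 0 < (h.ext z).im
  rw [h.ext_im]
  exact mul_pos h.derivConst_pos (mapsTo_joukowski (h.mapsTo_mapF hz))

/-- `E` maps `ℍₒ ∖ A` ONTO `ℍₒ`. [folklore] -/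
theorem surjOn_ext : SurjOn h.ext (upperHalfPlaneSet \ A) upperHalfPlaneSet := by
  intro ζ hζ
  have hc := h.derivConst_pos
  set ζ' : ℂ := ζ / h.derivConst + h.joukowskiZero with hζ'
  have hζ'H : ζ' ∈ upperHalfPlaneSet := by
    show 0 < ζ'.im
    rw [hζ', add_im, ofReal_im, add_zero, div_ofReal_im]
    exact div_pos hζ hc
  obtain ⟨w, hw, hJw⟩ := surjOn_joukowski hζ'H
  obtain ⟨z, hz, hFz⟩ := h.surjOn_mapF hw
  refine ⟨z, hz, ?_⟩
  have hc' : (h.derivConst : ℂ) ≠ 0 := ofReal_ne_zero.2 hc.ne'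
  rw [ext_def, hFz, hJw, hζ', add_sub_cancel_right, mul_div_cancel₀ _ hc']

/-- `E` maps `ℍₒ ∖ A` bijectively onto `ℍₒ`. [folklore] -/
theorem bijOn_ext : BijOn h.ext (upperHalfPlaneSet \ A) upperHalfPlaneSet :=
  ⟨h.mapsTo_ext, h.injOn_ext.mono h.diff_subset_slitDomain, h.surjOn_ext⟩

/-- `E(ℍₒ ∖ A) = ℍₒ`. [folklore] -/
theorem image_ext_diff : h.ext '' (upperHalfPlaneSet \ A) = upperHalfPlaneSet := h.bijOn_ext.image_eq

/-- **The restriction map `Φ_A` of a one-sided hull**, as a conformal equivalence `ℍₒ ∖ A → ℍₒ`: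
the restriction of `E` (existence of `g_A`/`Φ_A`: Lawler (2005), §3.4 Prop. 3.36, pp. 68–69, by
symmetrization). [cite: LawlerSchrammWerner2003Restriction, §2 p. 8 (the maps Φ_A)] -/
def restrictionMap : ConformalEquiv (upperHalfPlaneSet \ A) upperHalfPlaneSet :=
  ConformalEquiv.ofBijOn h.ext (h.differentiableOn_ext.mono h.diff_subset_slitDomain) h.bijOn_ext (by
    have key := Complex.differentiableOn_invFunOn_image h.isOpen_diff
      (h.differentiableOn_ext.mono h.diff_subset_slitDomain) (h.injOn_ext.mono h.diff_subset_slitDomain)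
      fun z hz ↦ h.deriv_ext_ne_zero (h.diff_subset_slitDomain hz)
    rwa [h.image_ext_diff] at key)

/-- `Φ_A` acts as `E`. [folklore] -/
@[simp] theorem restrictionMap_apply (z : ℂ) : h.restrictionMap z = h.ext z := rfl

/-- `E ∘ Φ_A⁻¹ = id` on `ℍₒ`. [folklore] -/
theorem ext_symm_apply {w : ℂ} (hw : w ∈ upperHalfPlaneSet) : h.ext (h.restrictionMap.symm w) = w :=
  h.restrictionMap.apply_symm_apply hw

/-- `Φ_A⁻¹` maps `ℍₒ` into `ℍₒ ∖ A`. [folklore] -/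
theorem symm_mem {w : ℂ} (hw : w ∈ upperHalfPlaneSet) : h.restrictionMap.symm w ∈ upperHalfPlaneSet \ A :=
  h.restrictionMap.symm_mapsTo hw

/-! #### Normalization at `∞`: `E(z)/z → 1` -/

omit h in
/-- `ι(z) → 0` as `z → ∞`. [folklore] -/
theorem tendsto_ofSlit_cocompact : Tendsto (ofSlit p) (cocompact ℂ) (𝓝 0) := by
  rw [← cobounded_eq_cocompact]
  exact tendsto_inv₀_cobounded.comp (tendsto_sub_const_cobounded (p : ℂ))

/-- **Hydrodynamic-type normalization**: `E(z)/z → 1` as `z → ∞`. With `g = dslope f 0`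
(`f(w) = w g(w)`, `g(0) = f'(0) = c`) and `w = ι(z)`, `E(z)/z = c (w² g(w) + g(w)⁻¹ - J₀ w)/(p w + 1) → 1`. [folklore] -/
theorem tendsto_ext_div : Tendsto (fun z ↦ h.ext z / z) (cocompact ℂ) (𝓝 1) := by
  set f := h.riemannMap with hf
  set c := h.derivConst with hc
  set g : ℂ → ℂ := dslope f 0 with hg
  have hc0 : (c : ℂ) ≠ 0 := ofReal_ne_zero.2 h.derivConst_pos.ne'
  have hfg : ∀ w, f w = w * g w := fun w ↦ by
    have := sub_smul_dslope (f : ℂ → ℂ) 0 w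
    rw [sub_zero, smul_eq_mul, h.riemannMap_zero, sub_zero] at this
    exact this.symm
  have hg0 : g 0 = c := by rw [hg, dslope_same, hf, h.deriv_riemannMap_zero]
  have hgc : ContinuousAt g 0 :=
    continuousAt_dslope_same.2 (h.differentiableAt_riemannMap zero_mem_slitBall)
  set J₀ : ℂ := (h.joukowskiZero : ℂ) with hJ₀
  set hh : ℂ → ℂ := fun w ↦ c * (w ^ 2 * g w + (g w)⁻¹ - J₀ * w) / (p * w + 1) with hhh
  have hh0 : hh 0 = 1 := by
    simp only [hhh, hg0]
    field_simp
    ring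
  have hhc : ContinuousAt hh 0 := by
    simp only [hhh]
    refine ContinuousAt.div (continuousAt_const.mul ((((continuousAt_id.pow 2).mul hgc).add
      (hgc.inv₀ (by rw [hg0]; exact hc0))).sub (continuousAt_const.mul continuousAt_id)))
      ((continuousAt_const.mul continuousAt_id).add continuousAt_const) ?_
    simp
  have hlim : Tendsto (fun z ↦ hh (ofSlit p z)) (cocompact ℂ) (𝓝 1) := by
    rw [← hh0]
    exact hhc.tendsto.comp tendsto_ofSlit_cocompact
  refine hlim.congr' ?_
  -- eventually `z ≠ p`, `z ≠ 0`, `g (ι z) ≠ 0`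
  have hev1 : ∀ᶠ z in cocompact ℂ, z ≠ (p : ℂ) ∧ z ≠ 0 := by
    have : ({(p : ℂ)} ∪ {0})ᶜ ∈ cocompact ℂ := (isCompact_singleton.union isCompact_singleton).compl_mem_cocompact
    filter_upwards [this] with z hz
    simp only [mem_compl_iff, mem_union, mem_singleton_iff, not_or] at hz
    exact hz
  have hev2 : ∀ᶠ z in cocompact ℂ, g (ofSlit p z) ≠ 0 := by
    have hne : {v : ℂ | v ≠ 0} ∈ 𝓝 (g 0) := by
      rw [hg0]; exact isOpen_compl_singleton.mem_nhds hc0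
    exact (hgc.tendsto.comp tendsto_ofSlit_cocompact).eventually hne
  filter_upwards [hev1, hev2] with z ⟨hzp, hz0⟩ hgz
  set w := ofSlit p z with hw
  have hw0 : w ≠ 0 := ofSlit_ne_zero hzp
  have hzw : z = (p : ℂ) + w⁻¹ := (toSlit_ofSlit hzp).symm
  have hden : (p : ℂ) * w + 1 ≠ 0 := by
    have : (p : ℂ) * w + 1 = z * w := by rw [hzw]; field_simp
    rw [this]
    exact mul_ne_zero hz0 hw0
  simp only [hhh, ext_def, mapF_def, ← hw, ← hf, hfg w, joukowski]
  rw [hzw]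
  field_simp
  ring

/-- `Φ_A` is a restriction map of `A`: boundary value `0` at `0` and `Φ_A(z)/z → 1` at `∞`.
[cite: LawlerSchrammWerner2003Restriction, §2 p. 8 (the maps Φ_A)] -/
theorem isRestrictionMap : IsRestrictionMap A h.restrictionMap := by
  refine ⟨?_, ?_⟩
  · show Tendsto (fun z ↦ h.ext z) (𝓝[upperHalfPlaneSet \ A] 0) (𝓝 0)
    have := (h.differentiableAt_ext h.zero_mem_slitDomain).continuousAt.tendsto
    rw [h.ext_zero] at this
    exact this.mono_left nhdsWithin_le_nhds
  · exact h.tendsto_ext_div.mono_left inf_le_left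

/-! #### The derivative at `0` -/

omit h in
/-- A complex derivative at a real point of a function real on nearby reals is real. [folklore] -/
theorem im_eq_zero_of_hasDerivAt_real {φ : ℂ → ℂ} {D : ℂ} {x₀ : ℝ} (hφ : HasDerivAt φ D x₀)
    (hreal : ∀ᶠ t : ℝ in 𝓝 x₀, (φ t).im = 0) : D.im = 0 := by
  have h1 := (hφ.comp_ofReal).tendsto_slope_zero
  have h0 : (φ x₀).im = 0 := hreal.self_of_nhds
  have hshift : ∀ᶠ t : ℝ in 𝓝 0, (φ ((x₀ + t : ℝ) : ℂ)).im = 0 := by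
    have : Tendsto (fun t : ℝ ↦ x₀ + t) (𝓝 0) (𝓝 x₀) := by
      have := (tendsto_const_nhds (x := x₀)).add (tendsto_id (x := 𝓝 (0 : ℝ)))
      rwa [add_zero] at this
    exact this.eventually hreal
  have hev : ∀ᶠ t : ℝ in 𝓝[≠] 0, (t⁻¹ • (φ ((x₀ + t : ℝ) : ℂ) - φ x₀)).im = 0 := by
    filter_upwards [nhdsWithin_le_nhds hshift] with t ht
    rw [Complex.smul_im, sub_im, ht, h0, sub_zero, smul_zero]
  exact (isClosed_eq continuous_im continuous_const).mem_of_tendsto h1 hev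

/-- Real points near `0` lie in `Ω`. [folklore] -/
theorem eventually_ofReal_mem_slitDomain : ∀ᶠ t : ℝ in 𝓝 0, (t : ℂ) ∈ slitDomain A p q :=
  continuous_ofReal.continuousAt.eventually (h.isOpen_slitDomain.mem_nhds (by simpa using h.zero_mem_slitDomain))

/-- `E'(0)` is real. [folklore] -/
theorem deriv_ext_zero_im : (deriv h.ext 0).im = 0 :=
  im_eq_zero_of_hasDerivAt_real (x₀ := 0) (by simpa using (h.differentiableAt_ext h.zero_mem_slitDomain).hasDerivAt)
    (h.eventually_ofReal_mem_slitDomain.mono fun _ ht ↦ h.ext_ofReal_im ht)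

/-- **The number `Φ_A'(0) = E'(0)`**. [cite: LawlerSchrammWerner2003Restriction, §2 (2.4) p. 7] -/
def restrictionDeriv : ℝ := (deriv h.ext 0).re

/-- `E'(0) = Φ_A'(0)`. [folklore] -/
theorem deriv_ext_zero : deriv h.ext 0 = (h.restrictionDeriv : ℂ) :=
  Complex.ext (by simp [restrictionDeriv]) (by simp [h.deriv_ext_zero_im])

omit h in
/-- `0 ∉ ℍₒ ∖ A`. [folklore] -/
theorem zero_notMem_diff : (0 : ℂ) ∉ upperHalfPlaneSet \ A := fun h0 ↦ by
  have : (0 : ℝ) < (0 : ℂ).im := h0.1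
  simp at this

/-- `Φ_A(z)/z → Φ_A'(0)` as `z → 0` in `ℍₒ ∖ A` (`E` is holomorphic at the interior point `0` of
`Ω`, `E(0) = 0`). [cite: LawlerSchrammWerner2003Restriction, §2 (2.4) p. 7] -/
theorem hasRestrictionDeriv : HasRestrictionDeriv A h.restrictionMap h.restrictionDeriv := by
  show Tendsto (fun z ↦ h.ext z / z) (𝓝[upperHalfPlaneSet \ A] 0) (𝓝 (h.restrictionDeriv : ℂ))
  have hd : HasDerivAt h.ext (h.restrictionDeriv : ℂ) 0 := by
    rw [← h.deriv_ext_zero]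
    exact (h.differentiableAt_ext h.zero_mem_slitDomain).hasDerivAt
  have h1 := hd.tendsto_slope_zero
  simp only [zero_add, h.ext_zero, sub_zero, smul_eq_mul] at h1
  have h2 : Tendsto (fun z ↦ h.ext z / z) (𝓝[≠] 0) (𝓝 (h.restrictionDeriv : ℂ)) :=
    h1.congr fun z ↦ by rw [div_eq_inv_mul]
  exact h2.mono_left (nhdsWithin_mono _ fun z hz hz0 ↦ zero_notMem_diff (by rwa [← show z = 0 from hz0]))

/-- The vertical approach `t ↦ t i`, `t ↓ 0`, within `ℍₒ ∖ A`. [folklore] -/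
theorem tendsto_mul_I_nhdsWithin :
    Tendsto (fun t : ℝ ↦ (t : ℂ) * I) (𝓝[>] 0) (𝓝[upperHalfPlaneSet \ A] 0) := by
  refine tendsto_nhdsWithin_iff.2 ⟨?_, ?_⟩
  · have : Continuous fun t : ℝ ↦ (t : ℂ) * I := by fun_prop
    simpa using (this.tendsto 0).mono_left nhdsWithin_le_nhds
  · have hA : ∀ᶠ t : ℝ in 𝓝 0, (t : ℂ) * I ∉ A := by
      have hc : Continuous fun t : ℝ ↦ (t : ℂ) * I := by fun_prop
      have h0 : (fun t : ℝ ↦ (t : ℂ) * I) 0 ∉ A := by simpa using h.isStarHull.zero_notMem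
      exact hc.continuousAt.eventually (h.isClosed_A.isOpen_compl.mem_nhds h0)
    filter_upwards [nhdsWithin_le_nhds hA, self_mem_nhdsWithin] with t htA ht
    exact ⟨show 0 < ((t : ℂ) * I).im by simpa using ht, htA⟩

omit h in
/-- Along `t i`: `re (w/(ti)) = im w / t`. [folklore] -/
theorem re_div_mul_I (w : ℂ) {t : ℝ} (ht : t ≠ 0) : (w / ((t : ℂ) * I)).re = w.im / t := by
  rw [Complex.div_re]
  have h1 : ((t : ℂ) * I).re = 0 := by simp
  have h2 : ((t : ℂ) * I).im = t := by simp
  have h3 : normSq ((t : ℂ) * I) = t * t := by simp [normSq_mul]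
  rw [h1, h2, h3, mul_zero, zero_div, zero_add, mul_div_mul_right _ _ ht]

/-- **`Φ_A'(0) > 0`**: `E` maps `ℍₒ ∖ A` into `ℍₒ`, so `re (E(ti)/(ti)) = im E(ti)/t > 0`, and
`E'(0) ≠ 0` (`E` is injective). [cite: LawlerSchrammWerner2003Restriction, §2 (2.4) p. 7] -/
theorem restrictionDeriv_pos : 0 < h.restrictionDeriv := by
  have hlim := ((continuous_re.tendsto _).comp (h.hasRestrictionDeriv.comp h.tendsto_mul_I_nhdsWithin))
  rw [ofReal_re] at hlim
  have hge : 0 ≤ h.restrictionDeriv := by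
    refine ge_of_tendsto hlim ?_
    filter_upwards [self_mem_nhdsWithin, h.tendsto_mul_I_nhdsWithin.eventually self_mem_nhdsWithin]
      with t ht htU
    show 0 ≤ (h.restrictionMap ((t : ℂ) * I) / ((t : ℂ) * I)).re
    rw [restrictionMap_apply, re_div_mul_I _ (ne_of_gt ht)]
    exact div_nonneg (le_of_lt (h.mapsTo_ext htU)) ht.le
  have hne : h.restrictionDeriv ≠ 0 := fun h0 ↦ by
    have := h.deriv_ext_ne_zero h.zero_mem_slitDomain
    rw [h.deriv_ext_zero, h0, ofReal_zero] at this
    exact this rfl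
  exact lt_of_le_of_ne hge (Ne.symm hne)

/-! #### Behaviour of `Φ_A⁻¹` at `0` and `∞` -/

/-- The image `E(Ω)` is open. [folklore] -/
theorem isOpen_image_ext : IsOpen (h.ext '' slitDomain A p q) :=
  Complex.isOpen_image_of_deriv_ne_zero h.isOpen_slitDomain h.differentiableOn_ext
    fun _ hz ↦ h.deriv_ext_ne_zero hz

/-- On `ℍₒ`, `Φ_A⁻¹` is the inverse of `E` on `Ω`. [folklore] -/
theorem symm_eq_invFunOn {w : ℂ} (hw : w ∈ upperHalfPlaneSet) :
    h.restrictionMap.symm w = Function.invFunOn h.ext (slitDomain A p q) w := by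
  have hz := h.symm_mem hw
  have hzΩ : h.restrictionMap.symm w ∈ slitDomain A p q := h.diff_subset_slitDomain hz
  have himg : w ∈ h.ext '' slitDomain A p q := ⟨_, hzΩ, h.ext_symm_apply hw⟩
  refine h.injOn_ext hzΩ (Function.invFunOn_mem himg) ?_
  rw [h.ext_symm_apply hw, Function.invFunOn_eq himg]

/-- **`Φ_A⁻¹(w) → 0` as `w → 0` in `ℍₒ`** (continuity at `0 = E(0)` of the inverse of the
injective holomorphic `E` on the open `Ω`). [folklore] -/
theorem tendsto_symm_nhdsWithin_zero : Tendsto h.restrictionMap.symm (𝓝[upperHalfPlaneSet] 0) (𝓝 0) := by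
  have hcont : ContinuousOn (Function.invFunOn h.ext (slitDomain A p q)) (h.ext '' slitDomain A p q) :=
    (Complex.differentiableOn_invFunOn_image h.isOpen_slitDomain h.differentiableOn_ext h.injOn_ext
      fun _ hz ↦ h.deriv_ext_ne_zero hz).continuousOn
  have h0 : (0 : ℂ) ∈ h.ext '' slitDomain A p q := ⟨0, h.zero_mem_slitDomain, h.ext_zero⟩
  have hinv0 : Function.invFunOn h.ext (slitDomain A p q) 0 = 0 := by
    have := h.injOn_ext.leftInvOn_invFunOn h.zero_mem_slitDomain
    rwa [h.ext_zero] at this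
  have hca : ContinuousAt (Function.invFunOn h.ext (slitDomain A p q)) 0 :=
    (hcont 0 h0).continuousAt (h.isOpen_image_ext.mem_nhds h0)
  have ht := hca.tendsto
  rw [hinv0] at ht
  refine (ht.mono_left nhdsWithin_le_nhds).congr' ?_
  filter_upwards [self_mem_nhdsWithin] with w hw
  exact (h.symm_eq_invFunOn hw).symm

/-- An upper bound for `‖E‖` in terms of `‖F‖⁻¹`. [folklore] -/
theorem norm_ext_le {z : ℂ} (hz : z ∈ slitDomain A p q) :
    ‖h.ext z‖ ≤ h.derivConst * (1 + ‖h.mapF z‖⁻¹ + |h.joukowskiZero|) := by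
  rw [ext_def, norm_mul, norm_real, Real.norm_of_nonneg h.derivConst_pos.le]
  refine mul_le_mul_of_nonneg_left ?_ h.derivConst_pos.le
  calc ‖joukowski (h.mapF z) - h.joukowskiZero‖ ≤ ‖joukowski (h.mapF z)‖ + ‖(h.joukowskiZero : ℂ)‖ :=
        norm_sub_le _ _
    _ ≤ (‖h.mapF z‖ + ‖(h.mapF z)⁻¹‖) + |h.joukowskiZero| := by
        rw [norm_real, Real.norm_eq_abs, joukowski]
        linarith [norm_add_le (h.mapF z) (h.mapF z)⁻¹]
    _ ≤ 1 + ‖h.mapF z‖⁻¹ + |h.joukowskiZero| := by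
        rw [norm_inv]
        linarith [h.norm_mapF_lt_one hz]

/-- **`Φ_A⁻¹(w) → ∞` as `w → ∞` in `ℍₒ`**: `‖E(z)‖` large forces `F(z)` small, i.e. `ι(z)` small
(continuity of `f⁻¹` at `0`), i.e. `z` large. [folklore] -/
theorem tendsto_symm_cocompact :
    Tendsto h.restrictionMap.symm (cocompact ℂ ⊓ 𝓟 upperHalfPlaneSet) (cocompact ℂ) := by
  rw [← cobounded_eq_cocompact (α := ℂ)]
  refine (Filter.hasBasis_cobounded_norm.inf_principal _).tendsto_iff Filter.hasBasis_cobounded_norm |>.2 ?_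
  intro R _
  -- continuity of `f⁻¹` at `0`
  set ε : ℝ := (|R| + |p| + 1)⁻¹ with hε
  have hεpos : 0 < ε := by rw [hε]; positivity
  have hfs : ContinuousAt h.riemannMap.symm 0 :=
    (h.riemannMap.symm.differentiableOn_coe.differentiableAt (isOpen_ball.mem_nhds (mem_ball_self one_pos))).continuousAt
  have hfs0 : h.riemannMap.symm 0 = 0 := by
    have := h.riemannMap.symm_apply_apply zero_mem_slitBall
    rwa [h.riemannMap_zero] at this
  obtain ⟨δ, hδ, hδε⟩ := Metric.continuousAt_iff.1 hfs ε hεpos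
  set M : ℝ := h.derivConst * (1 + δ⁻¹ + |h.joukowskiZero|) with hM
  refine ⟨M + 1, trivial, ?_⟩
  rintro w ⟨hwM, hwH⟩
  simp only [mem_setOf_eq] at hwM ⊢
  set z := h.restrictionMap.symm w with hz
  have hzU : z ∈ upperHalfPlaneSet \ A := h.symm_mem hwH
  have hzΩ := h.diff_subset_slitDomain hzU
  have hEz : h.ext z = w := h.ext_symm_apply hwH
  -- `‖F z‖ < δ`
  have hF0 := h.mapF_ne_zero hzΩ
  have hFδ : ‖h.mapF z‖ < δ := by
    have h1 : M + 1 ≤ h.derivConst * (1 + ‖h.mapF z‖⁻¹ + |h.joukowskiZero|) := by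
      rw [← hEz] at hwM
      exact hwM.trans (h.norm_ext_le hzΩ)
    have h2 : δ⁻¹ < ‖h.mapF z‖⁻¹ := by
      by_contra hle
      push Not at hle
      have : h.derivConst * (1 + ‖h.mapF z‖⁻¹ + |h.joukowskiZero|) ≤ M := by
        rw [hM]
        exact mul_le_mul_of_nonneg_left (by linarith) h.derivConst_pos.le
      linarith
    exact (inv_lt_inv₀ hδ (norm_pos_iff.2 hF0)).1 h2
  -- hence `‖ι z‖ < ε`
  have hιε : ‖ofSlit p z‖ < ε := by
    have hmem : dist (h.mapF z) 0 < δ := by rwa [dist_zero_right]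
    have := hδε hmem
    rw [hfs0, dist_zero_right, mapF_def, h.riemannMap.symm_apply_apply (ofSlit_mem hzΩ)] at this
    exact this
  -- hence `z` is large
  have hzp : z ≠ p := ne_p_of_mem_slitDomain hzΩ
  have hnorm : ε⁻¹ < ‖z - p‖ := by
    rw [ofSlit, norm_inv] at hιε
    rwa [inv_lt_comm₀ (norm_pos_iff.2 (sub_ne_zero.2 hzp)) hεpos] at hιε
  rw [hε, inv_inv] at hnorm
  have htri : ‖z - p‖ ≤ ‖z‖ + ‖(p : ℂ)‖ := norm_sub_le _ _
  rw [norm_real, Real.norm_eq_abs] at htri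
  linarith [le_abs_self R]

/-- **`im Φ_A(z) ≤ im z`** on `ℍₒ ∖ A`: the boundary Julia lemma
`Complex.im_le_im_of_tendsto_sub_self` for the self-map `Φ_A⁻¹ + L` of `ℍₒ`, where
`E(z) - z → L ∈ ℝ` at `∞`. [folklore] -/
theorem im_ext_le_im {L : ℝ} (hL : Tendsto (fun z ↦ h.ext z - z) (cocompact ℂ) (𝓝 (L : ℂ)))
    {z : ℂ} (hz : z ∈ upperHalfPlaneSet \ A) : (h.ext z).im ≤ z.im := by
  set gfun : ℂ → ℂ := fun w ↦ h.restrictionMap.symm w + L with hg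
  have hgd : DifferentiableOn ℂ gfun upperHalfPlaneSet :=
    h.restrictionMap.symm.differentiableOn_coe.add_const _
  have hgmaps : MapsTo gfun upperHalfPlaneSet upperHalfPlaneSet := fun w hw ↦ by
    show 0 < (h.restrictionMap.symm w + L).im
    rw [add_im, ofReal_im, add_zero]
    exact (h.symm_mem hw).1
  have hglim : Tendsto (fun w ↦ gfun w - w) (cocompact ℂ ⊓ 𝓟 upperHalfPlaneSet) (𝓝 0) := by
    have h1 : Tendsto (fun w ↦ h.ext (h.restrictionMap.symm w) - h.restrictionMap.symm w - L)
        (cocompact ℂ ⊓ 𝓟 upperHalfPlaneSet) (𝓝 0) := by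
      have := (hL.sub_const (L : ℂ)).comp h.tendsto_symm_cocompact
      rw [sub_self] at this
      exact this
    have h2 := h1.neg
    rw [neg_zero] at h2
    refine h2.congr' ?_
    have hev : ∀ᶠ w in cocompact ℂ ⊓ 𝓟 upperHalfPlaneSet, w ∈ upperHalfPlaneSet :=
      mem_inf_of_right (mem_principal_self _)
    filter_upwards [hev] with w hw
    simp only [hg, h.ext_symm_apply hw]
    ring
  have key := Complex.im_le_im_of_tendsto_sub_self hgd hgmaps hglim (h.mapsTo_ext hz)
  rw [hg] at key
  simp only [add_im, ofReal_im, add_zero] at key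
  have hsymm : h.restrictionMap.symm (h.ext z) = z := by
    have := h.restrictionMap.symm_apply_apply hz
    rwa [restrictionMap_apply] at this
  rwa [hsymm] at key

/-! #### `E(z) - z → L ∈ ℝ` at `∞` -/

/-- `g = dslope f 0` is analytic, in particular differentiable, at `0`. [folklore] -/
theorem differentiableAt_dslope_riemannMap : DifferentiableAt ℂ (dslope h.riemannMap 0) 0 := by
  have han : AnalyticAt ℂ h.riemannMap 0 :=
    h.riemannMap.differentiableOn_coe.analyticAt (h.isOpen_slitBall.mem_nhds zero_mem_slitBall)
  obtain ⟨P, hP⟩ := han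
  exact hP.has_fpower_series_dslope_fslope.analyticAt.differentiableAt

/-- Real points near `0` lie in `G`, and `g = dslope f 0` is real there. [folklore] -/
theorem eventually_dslope_real : ∀ᶠ t : ℝ in 𝓝 0, (dslope h.riemannMap 0 t).im = 0 := by
  have hG : ∀ᶠ t : ℝ in 𝓝 0, (t : ℂ) ∈ slitBall A p q :=
    continuous_ofReal.continuousAt.eventually (h.isOpen_slitBall.mem_nhds (by simpa using zero_mem_slitBall (A := A) (p := p) (q := q)))
  filter_upwards [hG] with t ht
  by_cases ht0 : t = 0
  · rw [ht0, ofReal_zero, dslope_same, h.deriv_riemannMap_zero, ofReal_im]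
  · rw [dslope_of_ne _ (ofReal_ne_zero.2 ht0), slope_def_module, h.riemannMap_zero, sub_zero, sub_zero,
      ← conj_eq_iff_im]
    have hreal : conj (h.riemannMap t) = h.riemannMap t := by
      rw [← h.riemannMap_conj ht, conj_ofReal]
    rw [smul_eq_mul, map_mul, map_inv₀, conj_ofReal, hreal]

/-- **Second-order normalization**: `E(z) - z → L` at `∞` for a REAL constant `L`
(`L = -c J₀ - p - g'(0)/c`; `g'(0)` is real because `f` commutes with conjugation). [folklore] -/
theorem exists_tendsto_ext_sub : ∃ L : ℝ, Tendsto (fun z ↦ h.ext z - z) (cocompact ℂ) (𝓝 (L : ℂ)) := by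
  set f := h.riemannMap with hf
  set c := h.derivConst with hc
  set g : ℂ → ℂ := dslope f 0 with hg
  have hc0 : (c : ℂ) ≠ 0 := ofReal_ne_zero.2 h.derivConst_pos.ne'
  have hfg : ∀ w, f w = w * g w := fun w ↦ by
    have := sub_smul_dslope (f : ℂ → ℂ) 0 w
    rw [sub_zero, smul_eq_mul, h.riemannMap_zero, sub_zero] at this
    exact this.symm
  have hg0 : g 0 = c := by rw [hg, dslope_same, hf, h.deriv_riemannMap_zero]
  have hgd : DifferentiableAt ℂ g 0 := h.differentiableAt_dslope_riemannMap
  have hgc : ContinuousAt g 0 := hgd.continuousAt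
  -- `k = dslope g 0`, `g w - c = w k w`, `k 0 = g'(0)` real
  set k : ℂ → ℂ := dslope g 0 with hk
  have hgk : ∀ w, g w - c = w * k w := fun w ↦ by
    have := sub_smul_dslope g 0 w
    rw [sub_zero, smul_eq_mul, hg0] at this
    exact this.symm
  have hkc : ContinuousAt k 0 := continuousAt_dslope_same.2 hgd
  have hk0im : (k 0).im = 0 := by
    rw [hk, dslope_same]
    exact im_eq_zero_of_hasDerivAt_real (x₀ := 0) (by rw [ofReal_zero]; exact hgd.hasDerivAt)
      h.eventually_dslope_real
  set J₀ : ℂ := (h.joukowskiZero : ℂ) with hJ₀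
  -- the limit
  set L : ℝ := -(c * h.joukowskiZero) - p - ((k 0).re / c) with hLdef
  have hLc : (L : ℂ) = -(c * J₀) - p - k 0 / c := by
    have hk0 : ((k 0).re : ℂ) = k 0 := Complex.ext (by simp) (by simp [hk0im])
    rw [hLdef]
    push_cast
    rw [hk0]
  refine ⟨L, ?_⟩
  set hh : ℂ → ℂ := fun w ↦ c * w * g w - c * J₀ - p - (g w)⁻¹ * k w with hhh
  have hh0 : hh 0 = (L : ℂ) := by
    rw [hLc, hhh]
    simp only [hg0, mul_zero, zero_mul, zero_sub]
    field_simp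
  have hhc : ContinuousAt hh 0 := by
    simp only [hhh]
    refine (((((continuousAt_const.mul continuousAt_id).mul hgc).sub continuousAt_const).sub
      continuousAt_const).sub ((hgc.inv₀ (by rw [hg0]; exact hc0)).mul hkc))
  have hlim : Tendsto (fun z ↦ hh (ofSlit p z)) (cocompact ℂ) (𝓝 (L : ℂ)) := by
    rw [← hh0]
    exact hhc.tendsto.comp tendsto_ofSlit_cocompact
  refine hlim.congr' ?_
  have hev1 : ∀ᶠ z in cocompact ℂ, z ≠ (p : ℂ) := by
    filter_upwards [isCompact_singleton.compl_mem_cocompact] with z hz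
    simpa using hz
  have hev2 : ∀ᶠ z in cocompact ℂ, g (ofSlit p z) ≠ 0 := by
    have hne : {v : ℂ | v ≠ 0} ∈ 𝓝 (g 0) := by
      rw [hg0]; exact isOpen_compl_singleton.mem_nhds hc0
    exact (hgc.tendsto.comp tendsto_ofSlit_cocompact).eventually hne
  filter_upwards [hev1, hev2] with z hzp hgz
  set w := ofSlit p z with hw
  have hw0 : w ≠ 0 := ofSlit_ne_zero hzp
  have hzw : z = (p : ℂ) + w⁻¹ := (toSlit_ofSlit hzp).symm
  have hkw : k w = (g w - c) / w := by rw [hgk w]; field_simp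
  simp only [hhh, ext_def, mapF_def, ← hw, ← hf, hfg w, joukowski, hkw]
  rw [hzw]
  field_simp
  ring

/-- **[LSW] (2.4): `Φ_A'(0) ≤ 1`.** From `im E(ti) ≤ t`: `re (E(ti)/(ti)) = im E(ti)/t ≤ 1`. [cite: LawlerSchrammWerner2003Restriction, §2 (2.4) p. 7] -/
theorem restrictionDeriv_le_one : h.restrictionDeriv ≤ 1 := by
  obtain ⟨L, hL⟩ := h.exists_tendsto_ext_sub
  have hlim := ((continuous_re.tendsto _).comp (h.hasRestrictionDeriv.comp h.tendsto_mul_I_nhdsWithin))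
  rw [ofReal_re] at hlim
  refine le_of_tendsto hlim ?_
  filter_upwards [self_mem_nhdsWithin, h.tendsto_mul_I_nhdsWithin.eventually self_mem_nhdsWithin]
    with t ht htU
  show (h.restrictionMap ((t : ℂ) * I) / ((t : ℂ) * I)).re ≤ 1
  rw [restrictionMap_apply, re_div_mul_I _ (ne_of_gt ht), div_le_one ht]
  have := h.im_ext_le_im hL htU
  simpa using this

/-- `Φ_A'(0) ∈ (0, 1]` exists, for the constructed `Φ_A`. [cite: LawlerSchrammWerner2003Restriction, §2 (2.4) p. 7] -/
theorem exists_hasRestrictionDeriv_restrictionMap :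
    ∃ d : ℝ, 0 < d ∧ d ≤ 1 ∧ HasRestrictionDeriv A h.restrictionMap d :=
  ⟨h.restrictionDeriv, h.restrictionDeriv_pos, h.restrictionDeriv_le_one, h.hasRestrictionDeriv⟩

end IsSlitHull

/-! ### Uniqueness of restriction maps -/

section Unique

variable {A : Set ℂ} {Φ Ψ : ConformalEquiv (upperHalfPlaneSet \ A) upperHalfPlaneSet}

/-- **Uniqueness of `Φ_A`.** If `Φ` is a restriction map of `A` whose inverse tends to `0` at `0`
and to `∞` at `∞` (within `ℍₒ`), then every restriction map `Ψ` of `A` agrees with `Φ` on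
`ℍₒ ∖ A`: `Ψ ∘ Φ⁻¹` is a conformal automorphism of `ℍₒ` tending to `0` at `0` and to `∞` at `∞`,
hence a dilation `w ↦ c w` (`ConformalEquiv.exists_eqOn_smul_of_tendsto`), and `c = 1` by the
normalization at `∞`. [cite: LawlerSchrammWerner2003Restriction, §2 p. 8 (uniqueness of Φ_A)] -/
theorem IsRestrictionMap.eqOn_of_tendsto_symm (hΦ : IsRestrictionMap A Φ) (hΨ : IsRestrictionMap A Ψ)
    (h0 : Tendsto Φ.symm (𝓝[upperHalfPlaneSet] 0) (𝓝 0))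
    (hinf : Tendsto Φ.symm (cocompact ℂ ⊓ 𝓟 upperHalfPlaneSet) (cocompact ℂ)) :
    EqOn Ψ Φ (upperHalfPlaneSet \ A) := by
  set M : ConformalEquiv upperHalfPlaneSet upperHalfPlaneSet := Φ.symm.trans Ψ with hM
  have hMapp : ∀ w, M w = Ψ (Φ.symm w) := fun w ↦ rfl
  -- `Φ⁻¹` within `ℍₒ ∖ A`
  have hΦU : Tendsto Φ.symm (𝓝[upperHalfPlaneSet] 0) (𝓝[upperHalfPlaneSet \ A] 0) :=
    tendsto_nhdsWithin_iff.2 ⟨h0, eventually_nhdsWithin_of_forall fun w hw ↦ Φ.symm_mapsTo hw⟩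
  have hΦinf : Tendsto Φ.symm (cocompact ℂ ⊓ 𝓟 upperHalfPlaneSet)
      (cocompact ℂ ⊓ 𝓟 (upperHalfPlaneSet \ A)) :=
    tendsto_inf.2 ⟨hinf, tendsto_principal.2 (mem_inf_of_right fun w hw ↦ Φ.symm_mapsTo hw)⟩
  -- `M` at `0` and at `∞`
  have hM0 : Tendsto M (𝓝[upperHalfPlaneSet] 0) (𝓝 0) :=
    (hΨ.1.comp hΦU).congr fun w ↦ (hMapp w).symm
  have hMinf : Tendsto M (cocompact ℂ ⊓ 𝓟 upperHalfPlaneSet) (cocompact ℂ) :=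
    (hΨ.tendsto_cocompact.comp hΦinf).congr fun w ↦ (hMapp w).symm
  obtain ⟨c, hc, hMc⟩ := M.exists_eqOn_smul_of_tendsto hM0 hMinf
  -- `c = 1` from `M w / w → 1`
  have hlim : Tendsto (fun w ↦ M w / w) (cocompact ℂ ⊓ 𝓟 upperHalfPlaneSet) (𝓝 1) := by
    have h1 : Tendsto (fun z ↦ Ψ z / z * (Φ z / z)⁻¹) (cocompact ℂ ⊓ 𝓟 (upperHalfPlaneSet \ A))
        (𝓝 1) := by
      have := hΨ.2.mul (hΦ.2.inv₀ one_ne_zero)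
      rwa [inv_one, mul_one] at this
    refine (h1.comp hΦinf).congr' ?_
    have hev : ∀ᶠ w in cocompact ℂ ⊓ 𝓟 upperHalfPlaneSet, w ∈ upperHalfPlaneSet :=
      mem_inf_of_right (mem_principal_self _)
    filter_upwards [hev] with w hw
    have hz0 : Φ.symm w ≠ 0 := fun h0' ↦ by
      have : (0 : ℝ) < (Φ.symm w).im := (Φ.symm_mapsTo hw).1
      rw [h0'] at this
      simp at this
    simp only [Function.comp_apply, hMapp, Φ.apply_symm_apply hw]
    field_simp
  have hconst : Tendsto (fun w ↦ M w / w) (cocompact ℂ ⊓ 𝓟 upperHalfPlaneSet) (𝓝 (c : ℂ)) := by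
    refine tendsto_const_nhds.congr' ?_
    have hev : ∀ᶠ w in cocompact ℂ ⊓ 𝓟 upperHalfPlaneSet, w ∈ upperHalfPlaneSet :=
      mem_inf_of_right (mem_principal_self _)
    filter_upwards [hev] with w hw
    have hw0 : w ≠ 0 := fun h0' ↦ by
      have : (0 : ℝ) < w.im := hw
      rw [h0'] at this
      simp at this
    rw [hMc hw, mul_div_assoc, div_self hw0, mul_one]
  haveI := neBot_cocompact_inf_principal_upperHalfPlaneSet
  have hc1 : (c : ℂ) = 1 := tendsto_nhds_unique hconst hlim
  intro z hz
  have h1 : M (Φ z) = Ψ z := by rw [hMapp, Φ.symm_apply_apply hz]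
  rw [← h1, hMc (Φ.mapsTo hz)]
  show (c : ℂ) * Φ z = Φ z
  rw [hc1, one_mul]

/-- **Uniqueness for one-sided hulls**: every restriction map of a one-sided hull agrees with
the constructed `Φ_A` on `ℍₒ ∖ A`. [cite: LawlerSchrammWerner2003Restriction, §2 p. 8 (uniqueness of Φ_A)] -/
theorem IsSlitHull.eqOn_restrictionMap {p q : ℝ} (h : IsSlitHull A p q) (hΨ : IsRestrictionMap A Ψ) :
    EqOn Ψ h.restrictionMap (upperHalfPlaneSet \ A) :=
  h.isRestrictionMap.eqOn_of_tendsto_symm hΨ h.tendsto_symm_nhdsWithin_zero h.tendsto_symm_cocompact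

/-- **`Φ'_A(0) ∈ (0, 1]` for every restriction map of a one-sided hull** ([LSW] (2.4) at `x = 0`).
[cite: LawlerSchrammWerner2003Restriction, §2 (2.4) p. 7] -/
theorem IsSlitHull.exists_hasRestrictionDeriv {p q : ℝ} (h : IsSlitHull A p q) (hΨ : IsRestrictionMap A Ψ) :
    ∃ d : ℝ, 0 < d ∧ d ≤ 1 ∧ HasRestrictionDeriv A Ψ d := by
  refine ⟨h.restrictionDeriv, h.restrictionDeriv_pos, h.restrictionDeriv_le_one, ?_⟩
  refine h.hasRestrictionDeriv.congr' ?_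
  filter_upwards [self_mem_nhdsWithin] with z hz
  rw [h.eqOn_restrictionMap hΨ hz]

end Unique

end Slit

end Literature.Probability.RandomPlanarGeometry
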